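import Literature.MathematicalPhysics.QuantumFieldTheory.Balaban1983to89.B6AgreeLapV1Chart

/-!
# `Balaban1983to89.B6AgreeQaQV1Chart` — T. Bałaban, *Propagators and renormalization transformations for lattice gauge theories. II*, Commun.
# Math. Phys. **96** (1984) 223–250 [Balaban1984PropagatorsII], (2.89)–(2.91) p. 239: THE AVERAGING OPERATORS `Q*aQ` OF `T_□` AGREE WITH THE
# GLOBAL ONES NEAR `□` — item (d3-b) of the B6 fold owner's programme for the genuine k-level Proposition 2.6 (B6-CLOSURE.md §5 items 7–10):
# the index sets `Λ_j`, `Λ_{j+1}` of `𝔅` near `□` read through the level charts ARE the member's `Λ^c ⊔ Λ′` of (2.89)/(2.97), the iterated block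
# averages `Q_k` commute with the window chart on deep blocks, and hence the `Q*aQ`-HALF of the ring hypothesis `hagree` of
# `B6GlobalChartV1.prop26_2136_V1_of_2134_eq291`; with the `Δ`-half of (d3-a) `B6AgreeLapV1Chart` this gives `hagree` ASSEMBLED

statement-level skeleton of published theorems with citation tags; proofs where landed; nothing here is a claim about the Yang–Mills mass gap

PDF held: `paper:balaban1984-cmp96-propagators-rt-ii` (journal page = PDF page + 222); pp. 238–239 [PDF 16–17] re-read (text layer).  PRINT (verbatim,
p. 239): *"On this torus we define operators R, Δ_a as in (2.17), (2.19), but only two scales are present now. We define B^j(Λ′) = □̃² ∩ B^{j+1}(Λ_{j+1}),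
(2.89) and we take Q′*aQ′, Q*aQ equal to Q′_{j+1}a_{j+1}Q′_{j+1}, Q_{j+1}a_{j+1}Q_{j+1} on B^j(Λ′), and to Q_j*a_jQ_j, Q′_j*a_jQ′_j on T_□ ∖ B^j(Λ′)
… G_□ = (Δ − ∂P_□∂* + Q*aQ)⁻¹. (2.90)"*; [Balaban1984PropagatorsI] (1.8), (1.11) p. 19 (straight contours stay in `B(c₋) ∪ B(c₊)`), (1.18) p. 20
(the one-stroke formula for `Q_k`).

CITATION HEADER (lean-in-tree rule) — WHAT IS REPRODUCED.  Phase-2 file of the `lit-balaban` typed skeleton (HOME `run/shared/lean/pub/lit-balaban/`),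
unit `lit-balaban-r03` (B6 fold owner; r03 gen 19, literature-prover-lit-balaban-r03-g19-0), referee ref-4.  SKELETON rows **B6.Eq2.89** × **B6.Eq2.90** ×
**B6.Eq2.91** × **B6.Prop2.6** (cells; decls of record untouched).  Sibling and import: (d3-a) `B6AgreeLapV1Chart` (p346067: the chart calculus
`WChart`/`KAgree`/`KLocal`/`KAgree.mul_mulOp`, the V1 window charts `eS/eB`, `DeepS/DeepB`, `cB`, `agree_lapV_member`, `deltaAE_split` (= `hΔ`),
`hinvl_GlV1` (= `hinvl`)).  IMPORTS BY NAME, restating nothing: `B6SectAOperatorsV1` (`QE`, `aE`, `QsE := (QE)†`, `BondIdx`, `dE/dsE/dcE/dcsE`),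
`B6SectADomainsV1.Domains` (`LamBond`, `le_of_lamBond`), `B6SectCTwoScaleV1` (`OutBond`, `InBond`, `CIdx`; the member's `Q = Q″Q_j`, `a = diag w`),
`B6Prop25TwoScaleCensus.TSIdx` (the member, `t.D = tsV1 …`), `B6SectAOntoV1.bondAvgIterLin`, `B5Eq118OneStroke` (`iterBlockOf`, `iterBlock`,
`val_iterBlockOf`, `bondAvgIter_eq_blockSum`), `B5AveragingLocalityV1.bondAvg_eq_zero_of_local` ((1.11)), `LatticeFieldCalculus` (`runSite`,
`segSum`, `bondAvg`, `bondAvgIter`), `B6Prop26ReachTransplant` (`restrictOp`, `transplant`, `transplant_add`, `chartBond`), Mathlib's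
`LinearMap.toMatrix'`, `Finset.sum_bij_ne_zero`, `Finset.sum_eq_add`, `Finset.sum_fin_eq_sum_range`, `Fintype.sum_sigma`.

THIS FILE (0 sorry; standard axioms; no `def … : Prop` fact, no hypothesis-shaped fact; defs WITH BODIES: the level charts `eSj`/`eBj`, the level
reading `wxG` of the weights of `𝔅`, the nearness predicate `NearB`).
* §1 THE LEVEL-`j′` CHARTS `eSj`/`eBj` (labels of `j′`-blocks minus `x₀/L^{j′}`, corner `x₀ ∈ L^{j′}ℤ^{d+1}`), `eSj_zero`, `sitesPerDir_zero_eq_mul`,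
  **`iterBlockOf_eS`** (BLOCKS ↦ BLOCKS: `y_{j′}(e x) = e_{j′}(y_{j′}(x))`), `val_eSj`, `iterBlockOf_window`, `eSj_inj`.
* §2 `runSite_mem_deepS`, **`eS_runSite`** (the chart intertwines straight contours of length ≤ the margin).
* §3 `segSum_chart`, `iterBlock_nonempty`, **`bondAvgIter_chart`**: `(Q_{j′}(ρA))(e_{j′}β) = (Q_{j′}A)(β)` for a `j′`-bond whose block keeps the margin
  `L^{j′}` and ANY bond function `A` (one-stroke formula (1.18), blocks ↦ blocks, contours ↦ contours).
* §4 the kernels: `toMatrix'_QE` (`Q(i,b) = (Q_{j′}δ_b)(β)`), `toMatrix'_aE_QE`, **`toMatrix'_QaQ`** (`(Q*aQ)(b,b₁) = Σ_{i∈𝔅} Q(i,b)w_iQ(i,b₁)`, `Q*` by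
  transpose), `toMatrix'_memberQ_inl/_inr`, `toMatrix'_member_aQ`, **`toMatrix'_memberQaQ`** (the member's, as `Σ_{Λ^c} + Σ_{Λ′}`).
* §5 **`bondAvgIter_eq_zero_of_local`** ((1.11) ITERATED: `(Q_kA)(β) = 0` if `A` vanishes on the fine bonds with end-blocks in `{β₋, β₊}`),
  `blocks_of_bondAvgIter_single_ne_zero` (`(Q_kδ_{b₁})(β) ≠ 0 ⇒ y_k(b₁₋) ∈ {β₋, β₊}`).
* §6 NEAR ⇒ DEEP: `deepS_of_iterBlockOf_eq` (same block: margin degrades by `L^k`), `deepS_of_iterBlockOf_unshift` (the block below: by `2L^k`),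
  `eSj_unshift_of_val`, **`deep_block_of_near`** (global torus), **`charted_of_member_near`** (member torus: a member `k`-bond seeing `e b₁`, `b₁`
  of margin `r + 2L^k`, IS `e_k β` for a global `β` with block of margin `r` — the member torus does not wrap near `e b₁`), `window_of_deep_block`.
* §7 `restrictOp_single(_of_not_mem)` (`ρδ_x = δ_{ex}` on the window, `0` off it), `wxG` + `wxG_idx/of_not_lam/of_lam`, **`sum_bondIdx_levels`**
  (`Σ_{i∈𝔅} = Σ_{n≤k} Σ_{n-bonds}`), **`bondAvgIter_single_chart`** (`(Q_kδ_b)(β) = [b ∈ window]·(Q_kδ_{eb})(e_kβ)` on deep blocks), `NearB`,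
  **`level_sum_chart`** (ONE LEVEL of the sandwich through the chart, by `Finset.sum_bij_ne_zero` on the near bonds), **`kagree_QaQ`**
  (`KAgree cB cB s (onFun Q*aQ) (onFun (Q*aQ)_□) (DeepB r)`, `r ≥ 3L^{j+1}`), **`agree_QaQ`** (`Q*aQ·h = s•(ε(Q*aQ)_□ρ)·h`).
* §8 **`hagree_member`** (`M·h = (c′/L^j)²•(ε M_□ ρ)·h`, `M = ∂*∂ + ∂∂* + Q*aQ`, `M_□ = Δ_□ + Q*a_□Q`, transplant along `chartBond` on the full
  window — the `Ml` of `hinvl_GlV1`), **`hagree_V1`** (`c′ = L^j`: `hagree` of `prop26_2136_V1_of_2134_eq291` LITERALLY, `M·h_□ = Ml·h_□`).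

THE HYPOTHESES OF `kagree_QaQ` (the index-set correspondence near `□`; shapes fixed here, to be discharged from the cube geometry — p21's `TDomains.sep`
(2.2), `domT`, «□ meets Λ_j» — in the assembly (d5)): `hL0` no index bond of a level `∉ {j, j+1}` is NEAR (sees a fine bond of margin `r`); `hLj` a near
`j`-bond is in `Λ_j` iff its chart is a `Λ^c`-bond of `T_□` (both end-blocks off `Λ′`); `hLj1` a near `(j+1)`-bond is in `Λ_{j+1}` iff its chart is
a `Λ′`-bond; `hWj`/`hWj1` the weights correspond, `w = s·w_□`; plus `L^{j+1} ∣ x₀`, `j + 1 ≤ m + K`, `r ≥ 3L^{j+1}`.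

HONEST SCOPE / DIVERGENCES. (1) As in (d3-a): full-period window inside the fundamental box of `T_η` (`x₀ ≥ 0`, `hfit`), V1 member torus of side
`2L^{m_□+K_□}` for print's `□̃³`. (2) UNITS (finding F1 of B6-CLOSURE §5 item 10): the averages carry no lattice factor, so agreement of `Q*aQ` needs
the WEIGHTS to correspond with the factor `s = (c′/L^j)²` that the `Δ`-part forces; `hagree_V1` (factor 1) serves members of ONE scale `j` with
`c′ = L^j` — the §5 assembly of `B6GlobalChartV1`; the genuine multi-scale assembly (d5) must use `hagree_member` with the scaled members. (3) The
correspondence hypotheses are NOT discharged here (they are statements about `𝒟`, `Λ_j`, `Λ_{j+1}` and the chosen `Λ′(□)`, (2.89)); in particular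
`hL0` is where print's separation (2.2) of the domains enters (finding F2: a `Λ_{j′}`-bond, `j′ ≥ j + 2`, CAN see a two-level window in general).
(4) Margin `3L^{j+1}` (blocks of near index bonds must keep the margin `L^{j+1}` for the one-stroke contours) — print's `□̃` has margins `M ≫ L`.
Value = typed skeleton + the proof of the third ring hypothesis of (2.91) modulo the geometric correspondence; NOT summit progress.
-/

noncomputable section

open scoped BigOperators Matrix
open Finset

namespace Literature.MathematicalPhysics.QuantumFieldTheory.Balaban1983to89.B6AgreeQaQV1Chart

open B6Prop26Gluing (mulOp mulOp_apply)
open B6Prop26ReachTransplant (restrictOp extendOp transplant restrictOp_apply restrictOp_apply_of_injOn transplant_apply transplant_add chartBond)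
open B6Prop25TwoScaleCensus (TSIdx)
open B6GlobalChartV1 (PV)
open B6Ineq2133TwoScaleV1 (onFun onFun_apply)
open B6AgreeLapV1Chart
open B5Eq118OneStroke (iterBlockOf iterBlock mem_iterBlock val_iterBlockOf bondAvgIter_eq_blockSum iterBlockOf_zero iterBlockOf_succ)
open LatticeFieldCalculus (runSite runBond segSum bondAvg bondAvgIter runSite_zero runSite_succ)

variable {d ℓ : ℕ} {hd : 1 ≤ d + 1} {hL : Odd (ℓ + 1) ∧ 1 < ℓ + 1} {a₀ a₁ : ℝ} {m K : ℕ}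

/-! ## §1  The level-`j′` site charts: `j′`-blocks of the window ↦ `j′`-blocks of `T_□` (corner `x₀ ∈ L^{j′}ℤ^{d+1}`) -/

section LevelCharts

variable (t : TSIdx d (ℓ + 1) hd hL a₀ a₁) (x₀ : Fin (d + 1) → ℤ)

/-- **THE LEVEL-`j′` SITE CHART**: a site of the unit lattice `T^{(j′)}` of the global torus (a `j′`-block of `T_η`) is sent to the site of the
member's `T^{(j′)}` with labels `val y_μ − x₀_μ/L^{j′}` modulo the member's period (for a corner `x₀ ∈ L^{j′}ℤ^{d+1}` the `j′`-blocks of the window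
ARE `j′`-blocks of `T_□`: p. 238 *"A cube □̃ is obtained from □ by taking a sum of 4^d big blocks"*). [cite: Balaban1984PropagatorsII, p.238 (□̃ ⊂ T_□ built of blocks), (2.89) p.239, dictionary] -/
def eSj (j' : ℕ) (y : Site (PV d ℓ m K hd hL) j') : Site t.P j' :=
  fun μ => ((((y μ).val : ℤ) - x₀ μ / (((ℓ + 1) ^ j' : ℕ) : ℤ) : ℤ) : ZMod (t.P.sitesPerDir j'))

/-- the level-`j′` bond chart (initial block charted, direction kept). [cite: Balaban1984PropagatorsII, p.238, (2.89) p.239, dictionary] -/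
def eBj (j' : ℕ) (β : PBond (PV d ℓ m K hd hL) j') : PBond t.P j' := ⟨eSj t x₀ j' β.src, β.dir⟩

variable {t x₀}

/-- at level `0` the level chart is the site chart `eS`. [cite: Balaban1984PropagatorsII, p.238, dictionary] -/
theorem eSj_zero (x : Site (PV d ℓ m K hd hL) 0) : eSj t x₀ 0 x = eS t x₀ x := by
  funext μ
  simp [eSj, eS]

/-- the fine period factors through the unit period: `2L^{m+K} = L^{j′}·2L^{m+K−j′}` (any `Params`, standing range). [cite: Balaban1987RG1, (0.1) p.251, dictionary] -/
theorem sitesPerDir_zero_eq_mul (P : Params) {j' : ℕ} (hj' : j' ≤ P.m + P.K) : P.sitesPerDir 0 = P.L ^ j' * P.sitesPerDir j' := by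
  simp only [Params.sitesPerDir, Nat.sub_zero]
  rw [mul_left_comm, ← pow_add, Nat.add_sub_cancel' hj']

/-- **BLOCKS ↦ BLOCKS**: the `j′`-block of a charted window site is the charted `j′`-block (corner in `L^{j′}ℤ^{d+1}`; both block maps are
`⌊label/L^{j′}⌋`, `val_iterBlockOf`). [cite: Balaban1984PropagatorsI, (1.6) p.18, (1.18) p.20; Balaban1984PropagatorsII, p.238, dictionary] -/
theorem iterBlockOf_eS {j' : ℕ} (hj' : j' ≤ m + K) (hj't : j' ≤ t.m + t.K) (hdiv : ∀ μ, ((((ℓ + 1) ^ j' : ℕ) : ℤ)) ∣ x₀ μ)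
    {x : Site (PV d ℓ m K hd hL) 0} (hx : x ∈ DeepS t x₀ 0) :
    iterBlockOf j' (eS t x₀ x) = eSj t x₀ j' (iterBlockOf j' x) := by
  funext μ
  have hLpos : (0 : ℤ) < (((ℓ + 1) ^ j' : ℕ) : ℤ) := by positivity
  obtain ⟨k, hk⟩ := hdiv μ
  -- the member side through its label
  have h1 : (((iterBlockOf j' (eS t x₀ x)) μ).val : ℤ) = (((x μ).val : ℤ) - x₀ μ) / (((ℓ + 1) ^ j' : ℕ) : ℤ) := by
    rw [val_iterBlockOf j' hj't, Int.natCast_div, val_eS hx μ]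
  have h2 : (((iterBlockOf j' x) μ).val : ℤ) = ((x μ).val : ℤ) / (((ℓ + 1) ^ j' : ℕ) : ℤ) := by
    rw [val_iterBlockOf j' hj', Int.natCast_div]
  rw [← ZMod.natCast_zmod_val ((iterBlockOf j' (eS t x₀ x)) μ)]
  show ((((iterBlockOf j' (eS t x₀ x)) μ).val : ℕ) : ZMod (t.P.sitesPerDir j')) =
    ((((((iterBlockOf j' x) μ).val : ℤ) - x₀ μ / (((ℓ + 1) ^ j' : ℕ) : ℤ) : ℤ)) : ZMod (t.P.sitesPerDir j'))
  rw [← Int.cast_natCast, h1, h2, hk, Int.mul_ediv_cancel_left _ hLpos.ne', mul_comm, Int.sub_mul_ediv_right _ _ hLpos.ne']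

/-- labels of charted `j′`-blocks of the window: `val (e_{j′} y)_μ = val y_μ − x₀_μ/L^{j′}` when `x₀/L^{j′} ≤ val y < x₀/L^{j′} + N′`.
[cite: Balaban1984PropagatorsII, p.238, dictionary] -/
theorem val_eSj {j' : ℕ} {y : Site (PV d ℓ m K hd hL) j'}
    (hy : ∀ μ, x₀ μ / (((ℓ + 1) ^ j' : ℕ) : ℤ) ≤ ((y μ).val : ℤ) ∧
      ((y μ).val : ℤ) < x₀ μ / (((ℓ + 1) ^ j' : ℕ) : ℤ) + (t.P.sitesPerDir j' : ℕ)) (μ : Fin (d + 1)) :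
    (((eSj t x₀ j' y) μ).val : ℤ) = ((y μ).val : ℤ) - x₀ μ / (((ℓ + 1) ^ j' : ℕ) : ℤ) := by
  obtain ⟨h1, h2⟩ := hy μ
  simp only [eSj, ZMod.val_intCast]
  exact Int.emod_eq_of_lt (by omega) (by omega)

/-- the `j′`-block of a window site has its labels in the window of `j′`-labels `[x₀/L^{j′}, x₀/L^{j′} + 2L^{m_□+K_□−j′})`. [cite: Balaban1984PropagatorsII, p.238, dictionary] -/
theorem iterBlockOf_window {j' : ℕ} (hj' : j' ≤ m + K) (hj't : j' ≤ t.m + t.K) (hdiv : ∀ μ, ((((ℓ + 1) ^ j' : ℕ) : ℤ)) ∣ x₀ μ)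
    {x : Site (PV d ℓ m K hd hL) 0} (hx : x ∈ DeepS t x₀ 0) (μ : Fin (d + 1)) :
    x₀ μ / (((ℓ + 1) ^ j' : ℕ) : ℤ) ≤ (((iterBlockOf j' x) μ).val : ℤ) ∧
      (((iterBlockOf j' x) μ).val : ℤ) < x₀ μ / (((ℓ + 1) ^ j' : ℕ) : ℤ) + (t.P.sitesPerDir j' : ℕ) := by
  have hLpos : (0 : ℤ) < (((ℓ + 1) ^ j' : ℕ) : ℤ) := by positivity
  obtain ⟨k, hk⟩ := hdiv μ
  obtain ⟨h1, h2⟩ := hx μ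
  have hN : ((t.P.sitesPerDir 0 : ℕ) : ℤ) = (((ℓ + 1) ^ j' : ℕ) : ℤ) * (t.P.sitesPerDir j' : ℕ) := by
    rw [sitesPerDir_zero_eq_mul t.P hj't]; push_cast; ring
  rw [val_iterBlockOf j' hj', Int.natCast_div, hk, Int.mul_ediv_cancel_left _ hLpos.ne']
  simp only [Nat.cast_zero, add_zero] at h1 h2
  rw [hk] at h1 h2
  rw [hN] at h2
  constructor
  · exact Int.le_ediv_of_mul_le hLpos (by linarith)
  · exact Int.ediv_lt_of_lt_mul hLpos (by linarith)

/-- the level chart is injective on the window blocks. [cite: Balaban1984PropagatorsII, p.238 (T_□ = □̃³), dictionary] -/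
theorem eSj_inj {j' : ℕ} {y y' : Site (PV d ℓ m K hd hL) j'}
    (hy : ∀ μ, x₀ μ / (((ℓ + 1) ^ j' : ℕ) : ℤ) ≤ ((y μ).val : ℤ) ∧
      ((y μ).val : ℤ) < x₀ μ / (((ℓ + 1) ^ j' : ℕ) : ℤ) + (t.P.sitesPerDir j' : ℕ))
    (hy' : ∀ μ, x₀ μ / (((ℓ + 1) ^ j' : ℕ) : ℤ) ≤ ((y' μ).val : ℤ) ∧
      ((y' μ).val : ℤ) < x₀ μ / (((ℓ + 1) ^ j' : ℕ) : ℤ) + (t.P.sitesPerDir j' : ℕ))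
    (h : eSj t x₀ j' y = eSj t x₀ j' y') : y = y' := by
  funext μ
  apply ZMod.val_injective
  have h1 := val_eSj hy μ
  have h2 := val_eSj hy' μ
  rw [h] at h1
  have : ((y μ).val : ℤ) = (y' μ).val := by linarith
  exact_mod_cast this

end LevelCharts

/-! ## §2  Straight contours through the chart: `e(x + t e_μ) = e(x) + t e_μ` for `t ≤` the margin -/

section Contours

variable {t : TSIdx d (ℓ + 1) hd hL a₀ a₁} {x₀ : Fin (d + 1) → ℤ}

/-- a site of margin `r + n` stays of margin `r` after `n` steps of a straight contour. [cite: Balaban1984PropagatorsI, (1.7) p.18 (straight contours), dictionary] -/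
theorem runSite_mem_deepS (hfit : ∀ μ, x₀ μ + (t.P.sitesPerDir 0 : ℕ) ≤ ((PV d ℓ m K hd hL).sitesPerDir 0 : ℕ))
    (μ : Fin (d + 1)) : ∀ (n : ℕ) {r : ℕ} {x : Site (PV d ℓ m K hd hL) 0}, x ∈ DeepS t x₀ (r + n) → runSite x μ n ∈ DeepS t x₀ r
  | 0, r, x, hx => by simpa using hx
  | n + 1, r, x, hx => by
    rw [runSite_succ]
    have h : runSite x μ n ∈ DeepS t x₀ (r + 1) := runSite_mem_deepS hfit μ n (r := r + 1) (by
      have : r + 1 + n = r + (n + 1) := by omega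
      rw [this]; exact hx)
    exact (shift_mem_deepS hfit h μ).1

/-- **THE CHART INTERTWINES STRAIGHT CONTOURS**: `e(x + n e_μ) = e(x) + n e_μ` for a site of margin `n` (the contour of (1.7)/(1.18) from `x`
does not leave the window). [cite: Balaban1984PropagatorsI, (1.7) p.18, (1.18) p.20; Balaban1984PropagatorsII, p.238, dictionary] -/
theorem eS_runSite (hfit : ∀ μ, x₀ μ + (t.P.sitesPerDir 0 : ℕ) ≤ ((PV d ℓ m K hd hL).sitesPerDir 0 : ℕ)) (μ : Fin (d + 1)) :
    ∀ (n : ℕ) {x : Site (PV d ℓ m K hd hL) 0}, x ∈ DeepS t x₀ n → eS t x₀ (runSite x μ n) = runSite (eS t x₀ x) μ n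
  | 0, x, _ => by simp
  | n + 1, x, hx => by
    rw [runSite_succ, runSite_succ]
    have h1 : runSite x μ n ∈ DeepS t x₀ 1 := runSite_mem_deepS hfit μ n (r := 1) (by rw [add_comm]; exact hx)
    rw [eS_shift hfit h1 μ, eS_runSite hfit μ n (deepS_mono (by omega) hx)]

end Contours

/-! ## §3  THE BLOCK AVERAGES `Q_{j′}` THROUGH THE CHART: `(Q_{j′}(ρA))(e β) = (Q_{j′}A)(β)` for a `j′`-bond `β` whose block keeps the margin `L^{j′}`
(one-stroke formula (1.18): the block `B^{j′}(β₋)` and its `L^{j′}`-contours are charted onto those of `e β`) -/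

section Averages

variable {t : TSIdx d (ℓ + 1) hd hL a₀ a₁} {x₀ : Fin (d + 1) → ℤ}
variable {hx₀ : ∀ μ, 0 ≤ x₀ μ} {hfit : ∀ μ, x₀ μ + (t.P.sitesPerDir 0 : ℕ) ≤ ((PV d ℓ m K hd hL).sitesPerDir 0 : ℕ)}

/-- a contour sum of the charted function along the charted contour is the contour sum (margin `n` at the initial site).
[cite: Balaban1984PropagatorsI, (1.8) p.19 («A(Γ) = Σ_{b⊂Γ} A_b»); Balaban1984PropagatorsII, p.238, dictionary] -/
theorem segSum_chart (A : PBond (PV d ℓ m K hd hL) 0 → ℝ) (μ : Fin (d + 1)) {n : ℕ} {x : Site (PV d ℓ m K hd hL) 0}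
    (hx : x ∈ DeepS t x₀ n) :
    segSum (restrictOp (cB t x₀ hx₀ hfit).W (eB t x₀) A) (eS t x₀ x) μ n = segSum A x μ n := by
  unfold segSum
  refine Finset.sum_congr rfl fun s hs => ?_
  have hsn : s ≤ n := (Finset.mem_range.1 hs).le
  have hxs : x ∈ DeepS t x₀ s := deepS_mono hsn hx
  have hrun : runBond (eS t x₀ x) μ s = eB t x₀ (runBond x μ s) := by
    show (⟨runSite (eS t x₀ x) μ s, μ⟩ : PBond t.P 0) = ⟨eS t x₀ (runSite x μ s), μ⟩
    rw [eS_runSite hfit μ s hxs]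
  have hW : runBond x μ s ∈ (cB t x₀ hx₀ hfit).W := by
    refine mem_cB_W.2 ?_
    show runSite x μ s ∈ DeepS t x₀ 0
    exact runSite_mem_deepS hfit μ s (r := 0) (by rw [zero_add]; exact hxs)
  rw [hrun]
  exact restrictOp_apply_of_injOn (cB t x₀ hx₀ hfit).inj A hW

/-- every block of order `j′` is inhabited (it has `L^{j′d}` sites). [cite: Balaban1984PropagatorsI, (1.18) p.20, dictionary] -/
theorem iterBlock_nonempty {P : Params} {j' : ℕ} (hj' : j' ≤ P.m + P.K) (y : Site P j') : (iterBlock j' y).Nonempty := by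
  rw [← Finset.card_pos, B5Eq118OneStroke.card_iterBlock j' hj']
  exact pow_pos (pow_pos P.L_pos _) _

/-- **`Q_{j′}` THROUGH THE CHART** (the analytic heart of (d3-b)): for a `j′`-bond `β` of the global torus whose block `B^{j′}(β₋)` keeps the margin
`L^{j′}` in the window, and ANY bond function `A`, the `j′`-fold average of the charted function at the charted bond is the average of `A` at `β`:
`(Q_{j′}(ρA))(e_{j′}β) = (Q_{j′}A)(β)` — by the one-stroke formula (1.18) (`bondAvgIter_eq_blockSum`), blocks ↦ blocks (`iterBlockOf_eS`) and
contours ↦ contours (`eS_runSite`). [cite: Balaban1984PropagatorsI, (1.18) p.20; Balaban1984PropagatorsII, (2.20) p.226, p.238–239 (Q on T_□), dictionary] -/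
theorem bondAvgIter_chart {j' : ℕ} (hj' : j' ≤ m + K) (hj't : j' ≤ t.m + t.K) (hdiv : ∀ μ, ((((ℓ + 1) ^ j' : ℕ) : ℤ)) ∣ x₀ μ)
    (β : PBond (PV d ℓ m K hd hL) j') (hβ : ∀ x, iterBlockOf j' x = β.src → x ∈ DeepS t x₀ ((ℓ + 1) ^ j'))
    (A : PBond (PV d ℓ m K hd hL) 0 → ℝ) :
    bondAvgIter j' (restrictOp (cB t x₀ hx₀ hfit).W (eB t x₀) A) (eBj t x₀ j' β) = bondAvgIter j' A β := by
  rw [bondAvgIter_eq_blockSum j' hj't, bondAvgIter_eq_blockSum j' hj']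
  show ((((((ℓ + 1 : ℕ) : ℝ)) ^ (d + 1 + 1)) ^ j')⁻¹) •
      ∑ x' ∈ iterBlock j' (eSj t x₀ j' β.src), segSum (restrictOp (cB t x₀ hx₀ hfit).W (eB t x₀) A) x' β.dir ((ℓ + 1) ^ j') =
    ((((((ℓ + 1 : ℕ) : ℝ)) ^ (d + 1 + 1)) ^ j')⁻¹) • ∑ x ∈ iterBlock j' β.src, segSum A x β.dir ((ℓ + 1) ^ j')
  congr 1
  symm
  refine Finset.sum_bij (fun x _ => eS t x₀ x) (fun x hx => ?_) (fun x hx x' hx' h => ?_) (fun x' hx' => ?_) (fun x hx => ?_)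
  · -- blocks ↦ blocks
    rw [mem_iterBlock] at hx ⊢
    rw [iterBlockOf_eS hj' hj't hdiv (deepS_mono (Nat.zero_le _) (hβ x hx)), hx]
  · rw [mem_iterBlock] at hx hx'
    exact eS_injOn (deepS_mono (Nat.zero_le _) (hβ x hx)) (deepS_mono (Nat.zero_le _) (hβ x' hx')) h
  · -- onto the charted block
    rw [mem_iterBlock] at hx'
    obtain ⟨x, hxW, rfl⟩ := eS_surj hx₀ hfit x'
    refine ⟨x, ?_, rfl⟩
    rw [mem_iterBlock]
    rw [iterBlockOf_eS hj' hj't hdiv hxW] at hx'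
    obtain ⟨x₁, hx₁⟩ := iterBlock_nonempty (P := PV d ℓ m K hd hL) hj' β.src
    rw [mem_iterBlock] at hx₁
    have hw₁ := iterBlockOf_window hj' hj't hdiv (deepS_mono (Nat.zero_le _) (hβ x₁ hx₁))
    rw [hx₁] at hw₁
    exact eSj_inj (iterBlockOf_window hj' hj't hdiv hxW) hw₁ hx'
  · rw [mem_iterBlock] at hx
    exact (segSum_chart A β.dir (hβ x hx)).symm

end Averages

/-! ## §4  Kernels of the averaging operators: the multi-scale `Q` (2.20), `aQ`, the member's `Q = Q″Q_j` (2.119), and the SANDWICHES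
`Q*aQ` of both sides as index sums `Σ_i Q(i,b)·w_i·Q(i,b₁)` -/

section QKernels

open B6SectAOperatorsV1 (QE aE QsE BondIdx)
open B6SectADomainsV1 (Domains)
open B6SectCTwoScaleV1 (OutBond InBond CIdx)

/-- the kernel of the multi-scale `Q` of (2.20): `Q(i, b) = (Q_{j′}δ_b)(β)` for the index bond `i = (j′, β)`. [cite: Balaban1984PropagatorsII, (2.20) p.226, dictionary] -/
theorem toMatrix'_QE {P : Params} (Dm : Domains P) (i : BondIdx Dm) (b : PBond P 0) :
    LinearMap.toMatrix' (onFun (QE Dm)) i b = bondAvgIter (i.1.1 : ℕ) (Pi.single b (1 : ℝ)) i.1.2 := by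
  rw [LinearMap.toMatrix'_apply]; rfl

/-- the kernel of `aQ`: `(aQ)(i, b) = w_i·(Q_{j′}δ_b)(β)`. [cite: Balaban1984PropagatorsII, (2.18)–(2.20) p.226, dictionary] -/
theorem toMatrix'_aE_QE {P : Params} (Dm : Domains P) (w : BondIdx Dm → ℝ) (i : BondIdx Dm) (b : PBond P 0) :
    LinearMap.toMatrix' (onFun (aE Dm w ∘ₗ QE Dm)) i b = w i * bondAvgIter (i.1.1 : ℕ) (Pi.single b (1 : ℝ)) i.1.2 := by
  rw [LinearMap.toMatrix'_apply]; rfl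

/-- **THE GLOBAL SANDWICH KERNEL**: `(Q*aQ)(b, b₁) = Σ_{i ∈ 𝔅} Q(i,b)·w_i·Q(i,b₁)`. [cite: Balaban1984PropagatorsII, (2.18)–(2.20) p.226, dictionary] -/
theorem toMatrix'_QaQ {P : Params} (Dm : Domains P) (w : BondIdx Dm → ℝ) (b b₁ : PBond P 0) :
    LinearMap.toMatrix' (onFun (QsE Dm ∘ₗ aE Dm w ∘ₗ QE Dm)) b b₁ =
      ∑ i : BondIdx Dm, bondAvgIter (i.1.1 : ℕ) (Pi.single b (1 : ℝ)) i.1.2 * (w i * bondAvgIter (i.1.1 : ℕ) (Pi.single b₁ (1 : ℝ)) i.1.2) := by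
  rw [onFun_comp, toMatrix'_comp_apply]
  refine Finset.sum_congr rfl fun i _ => ?_
  rw [QsE, toMatrix'_onFun_adjoint, Matrix.transpose_apply, toMatrix'_QE, toMatrix'_aE_QE]

variable (t : TSIdx d (ℓ + 1) hd hL a₀ a₁)

/-- the kernel of the member's `Q = Q″Q_j` on a `Λ^c`-bond: `Q(β′, b′) = (Q_jδ_{b′})(β′)`. [cite: Balaban1984PropagatorsII, (2.97) p.240, (2.119) p.243, dictionary] -/
theorem toMatrix'_memberQ_inl (β' : OutBond t.j t.Λ') (b' : PBond t.P 0) :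
    LinearMap.toMatrix' (onFun t.D.Q) (Sum.inl β') b' = bondAvgIter t.j (Pi.single b' (1 : ℝ)) β'.1 := by
  rw [LinearMap.toMatrix'_apply]; rfl

/-- the kernel of the member's `Q` on a `Λ′`-bond: `Q(η′, b′) = (Q_{j+1}δ_{b′})(η′)`. [cite: Balaban1984PropagatorsII, (2.97) p.240, (2.119) p.243, dictionary] -/
theorem toMatrix'_memberQ_inr (η' : InBond t.j t.Λ') (b' : PBond t.P 0) :
    LinearMap.toMatrix' (onFun t.D.Q) (Sum.inr η') b' = bondAvgIter (t.j + 1) (Pi.single b' (1 : ℝ)) η'.1 := by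
  rw [LinearMap.toMatrix'_apply]; rfl

/-- the kernel of the member's `aQ`: `(aQ)(i′, b′) = w_{i′}·Q(i′, b′)`. [cite: Balaban1984PropagatorsII, (2.97) p.240, dictionary] -/
theorem toMatrix'_member_aQ (i' : CIdx t.j t.Λ') (b' : PBond t.P 0) :
    LinearMap.toMatrix' (onFun (t.D.a ∘ₗ t.D.Q)) i' b' = t.w i' * LinearMap.toMatrix' (onFun t.D.Q) i' b' := by
  rw [LinearMap.toMatrix'_apply, LinearMap.toMatrix'_apply]; rfl

/-- **THE MEMBER'S SANDWICH KERNEL**: `(Q*aQ)_□(b′, b′₁) = Σ_{β′ ∈ Λ^c} (Q_jδ_{b′})(β′)·w_{β′}·(Q_jδ_{b′₁})(β′) + Σ_{η′ ∈ Λ′} (Q_{j+1}δ_{b′})(η′)·w_{η′}·(Q_{j+1}δ_{b′₁})(η′)`.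
[cite: Balaban1984PropagatorsII, (2.89)–(2.90) p.239, (2.97) p.240, dictionary] -/
theorem toMatrix'_memberQaQ (b' b'₁ : PBond t.P 0) :
    LinearMap.toMatrix' (onFun (LinearMap.adjoint t.D.Q ∘ₗ t.D.a ∘ₗ t.D.Q)) b' b'₁ =
      (∑ β' : OutBond t.j t.Λ', bondAvgIter t.j (Pi.single b' (1 : ℝ)) β'.1 * (t.w (Sum.inl β') * bondAvgIter t.j (Pi.single b'₁ (1 : ℝ)) β'.1)) +
      ∑ η' : InBond t.j t.Λ', bondAvgIter (t.j + 1) (Pi.single b' (1 : ℝ)) η'.1 * (t.w (Sum.inr η') * bondAvgIter (t.j + 1) (Pi.single b'₁ (1 : ℝ)) η'.1) := by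
  rw [onFun_comp, toMatrix'_comp_apply, Fintype.sum_sum_type]
  congr 1
  · refine Finset.sum_congr rfl fun β' _ => ?_
    rw [toMatrix'_onFun_adjoint, Matrix.transpose_apply, toMatrix'_member_aQ, toMatrix'_memberQ_inl, toMatrix'_memberQ_inl]
  · refine Finset.sum_congr rfl fun η' _ => ?_
    rw [toMatrix'_onFun_adjoint, Matrix.transpose_apply, toMatrix'_member_aQ, toMatrix'_memberQ_inr, toMatrix'_memberQ_inr]

end QKernels

/-! ## §5  BLOCK LOCALITY of the iterated averages and what a non-zero entry `(Q_kδ_{b₁})(β)` forces -/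

section Locality

/-- **ITERATED BLOCK LOCALITY OF `Q_k`** ((1.11) iterated): if the fine bond function vanishes on every fine bond whose end-points have their
`k`-blocks in `{β₋, β₊}`, then `(Q_kA)(β) = 0`. [cite: Balaban1984PropagatorsI, (1.11) p.19, (1.18) p.20, dictionary] -/
theorem bondAvgIter_eq_zero_of_local {P : Params} {V : Type*} [AddCommGroup V] [Module ℝ V] :
    ∀ (k : ℕ), k ≤ P.m + P.K → ∀ (A : VecField P 0 V) (β : PBond P k),
      (∀ b : PBond P 0, (iterBlockOf k b.src = β.src ∨ iterBlockOf k b.src = β.tgt) →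
        (iterBlockOf k b.tgt = β.src ∨ iterBlockOf k b.tgt = β.tgt) → A b = 0) → bondAvgIter k A β = 0
  | 0, _, A, β, h => by
    have hb : A β = 0 := h β (Or.inl rfl) (Or.inr rfl)
    simpa [bondAvgIter] using hb
  | k + 1, hk, A, β, h => by
    show bondAvg (bondAvgIter k A) β = 0
    refine B5AveragingLocalityV1.bondAvg_eq_zero_of_local hk _ β fun b' h₁ h₂ => ?_
    refine bondAvgIter_eq_zero_of_local k (by omega) A b' fun b hb₁ hb₂ => h b ?_ ?_
    · rw [iterBlockOf_succ]
      rcases hb₁ with e | e <;> rw [e]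
      · exact h₁
      · exact h₂
    · rw [iterBlockOf_succ]
      rcases hb₂ with e | e <;> rw [e]
      · exact h₁
      · exact h₂

/-- hence a non-zero entry `(Q_kδ_{b₁})(β) ≠ 0` forces the `k`-block of `b₁₋` to be `β₋` or `β₊` (and `b₁₊` likewise).
[cite: Balaban1984PropagatorsI, (1.11) p.19, (1.18) p.20, dictionary] -/
theorem blocks_of_bondAvgIter_single_ne_zero {P : Params} {k : ℕ} (hk : k ≤ P.m + P.K) {b₁ : PBond P 0} {β : PBond P k}
    (h : bondAvgIter k (Pi.single b₁ (1 : ℝ)) β ≠ 0) :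
    (iterBlockOf k b₁.src = β.src ∨ iterBlockOf k b₁.src = β.tgt) ∧ (iterBlockOf k b₁.tgt = β.src ∨ iterBlockOf k b₁.tgt = β.tgt) := by
  by_contra hne
  refine h (bondAvgIter_eq_zero_of_local k hk _ β fun b hb₁ hb₂ => ?_)
  rw [Pi.single_apply]
  split_ifs with hb
  · subst hb; exact absurd ⟨hb₁, hb₂⟩ hne
  · rfl

end Locality

/-! ## §6  NEAR ⇒ DEEP: an index bond whose average sees a deep fine bond has its whole block deep (labels of one block differ by `< L^k`),
on the global torus AND — through the level chart — on the member torus -/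

section NearDeep

variable {t : TSIdx d (ℓ + 1) hd hL a₀ a₁} {x₀ : Fin (d + 1) → ℤ}

/-- labels with the same quotient by `n` differ by less than `n`. [folklore] -/
private theorem near_of_div_eq {a b n : ℕ} (hn : 0 < n) (h : a / n = b / n) : a < b + n ∧ b < a + n := by
  have h1 := Nat.lt_div_mul_add (a := a) hn
  have h2 := Nat.div_mul_le_self b n
  have h3 := Nat.lt_div_mul_add (a := b) hn
  have h4 := Nat.div_mul_le_self a n
  rw [h] at h1
  rw [← h] at h3
  constructor <;> omega

/-- labels with consecutive quotients by `n`: `a < b < a + 2n`. [folklore] -/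
private theorem near_of_div_succ {a b n : ℕ} (hn : 0 < n) (h : a / n + 1 = b / n) : a < b ∧ b < a + 2 * n := by
  have h1 := Nat.lt_div_mul_add (a := a) hn
  have h3 := Nat.lt_div_mul_add (a := b) hn
  have h2 := Nat.div_mul_le_self b n
  have h4 := Nat.div_mul_le_self a n
  have h5 : b / n * n = a / n * n + n := by rw [← h, Nat.add_mul, one_mul]
  rw [h5] at h2 h3
  constructor <;> omega

/-- `val (y − e_μ)_μ = val y_μ − 1` away from the seam. [folklore] -/
private theorem qval_unshift_self {P : Params} {j : ℕ} (x : Site P j) (μ : Fin P.d) (h : 1 ≤ (x μ).val) :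
    ((x.unshift μ) μ).val = (x μ).val - 1 := by
  have h1 : (x.unshift μ) μ = x μ - 1 := by simp [Site.unshift]
  rw [h1, ZMod.val_sub (by rw [ZMod.val_one]; exact h), ZMod.val_one]

/-- the other coordinates of `x − e_μ`. [folklore] -/
private theorem qunshift_apply_ne {P : Params} {j : ℕ} (x : Site P j) {μ ν : Fin P.d} (h : ν ≠ μ) : (x.unshift μ) ν = x ν := by
  simp [Site.unshift, Function.update_of_ne h]

/-- `(x + e_μ) − e_μ = x`. [folklore] -/
private theorem qunshift_shift {P : Params} {j : ℕ} (x : Site P j) (μ : Fin P.d) : (x.shift μ).unshift μ = x := by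
  funext ν
  by_cases h : ν = μ
  · subst h; simp [Site.shift, Site.unshift]
  · simp [Site.shift, Site.unshift, Function.update_of_ne h]

/-- **SAME `k`-BLOCK ⇒ THE MARGIN DEGRADES BY `L^k`**: a fine site in the `k`-block of a site of margin `r + L^k` has margin `r`.
[cite: Balaban1984PropagatorsI, (1.18) p.20 (blocks B^k(y)); Balaban1984PropagatorsII, p.238 (□̃ built of blocks), dictionary] -/
theorem deepS_of_iterBlockOf_eq {k : ℕ} (hk : k ≤ m + K) {x z : Site (PV d ℓ m K hd hL) 0} (h : iterBlockOf k x = iterBlockOf k z)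
    {r : ℕ} (hz : z ∈ DeepS t x₀ (r + (ℓ + 1) ^ k)) : x ∈ DeepS t x₀ r := by
  intro μ
  have e : (x μ).val / (ℓ + 1) ^ k = (z μ).val / (ℓ + 1) ^ k := by
    have h1 := val_iterBlockOf (P := PV d ℓ m K hd hL) k hk x μ
    have h2 := val_iterBlockOf (P := PV d ℓ m K hd hL) k hk z μ
    rw [h] at h1
    exact h1.symm.trans h2
  obtain ⟨h1, h2⟩ := near_of_div_eq (pow_pos (Nat.succ_pos ℓ) k) e
  obtain ⟨hz1, hz2⟩ := hz μ
  generalize hN : (ℓ + 1) ^ k = N at h1 h2 hz1 hz2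
  constructor <;> omega

/-- a site of margin `≥ L^k` (corner `x₀ ≥ 0`) has a positive level-`k` block label. [cite: Balaban1984PropagatorsII, p.238, dictionary] -/
private theorem one_le_blockLabel {k : ℕ} (hk : k ≤ m + K) (hx₀ : ∀ μ, 0 ≤ x₀ μ) {z : Site (PV d ℓ m K hd hL) 0} {r : ℕ}
    (hz : z ∈ DeepS t x₀ (r + 2 * (ℓ + 1) ^ k)) (ν : Fin (d + 1)) : 1 ≤ ((iterBlockOf k z) ν).val := by
  rw [val_iterBlockOf (P := PV d ℓ m K hd hL) k hk z ν]
  refine Nat.div_pos ?_ (pow_pos (Nat.succ_pos ℓ) k)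
  have hz1 := (hz ν).1
  have h0 := hx₀ ν
  have ht : (0 : ℤ) ≤ ((ℓ : ℤ) + 1) ^ k := by positivity
  have : (((ℓ + 1) ^ k : ℕ) : ℤ) ≤ ((z ν).val : ℤ) := by push_cast at hz1 ⊢; linarith
  exact_mod_cast this

/-- **ADJACENT `k`-BLOCK (below, direction `μ`) ⇒ THE MARGIN DEGRADES BY `2L^k`**. [cite: Balaban1984PropagatorsI, (1.8) p.19 (B(c₋) ∪ B(c₊)), (1.18) p.20; Balaban1984PropagatorsII, p.238, dictionary] -/
theorem deepS_of_iterBlockOf_unshift {k : ℕ} (hk : k ≤ m + K) (hx₀ : ∀ μ, 0 ≤ x₀ μ) {x z : Site (PV d ℓ m K hd hL) 0} {μ : Fin (d + 1)}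
    (h : iterBlockOf k x = (iterBlockOf k z).unshift μ) {r : ℕ} (hz : z ∈ DeepS t x₀ (r + 2 * (ℓ + 1) ^ k)) : x ∈ DeepS t x₀ r := by
  have hLk : 0 < (ℓ + 1) ^ k := pow_pos (Nat.succ_pos ℓ) k
  intro ν
  obtain ⟨hz1, hz2⟩ := hz ν
  have hzq : ((iterBlockOf k z) ν).val = (z ν).val / (ℓ + 1) ^ k := val_iterBlockOf (P := PV d ℓ m K hd hL) k hk z ν
  have hxq : ((iterBlockOf k x) ν).val = (x ν).val / (ℓ + 1) ^ k := val_iterBlockOf (P := PV d ℓ m K hd hL) k hk x ν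
  have h' : (iterBlockOf k x) ν = ((iterBlockOf k z).unshift μ) ν := by rw [h]
  by_cases hν : ν = μ
  · subst hν
    have hzv : 1 ≤ ((iterBlockOf k z) ν).val := one_le_blockLabel hk hx₀ hz ν
    have e : (x ν).val / (ℓ + 1) ^ k + 1 = (z ν).val / (ℓ + 1) ^ k := by
      have h'' := congrArg ZMod.val h'
      rw [qval_unshift_self (P := PV d ℓ m K hd hL) (iterBlockOf k z) ν hzv, hxq, hzq] at h''
      rw [hzq] at hzv
      omega
    obtain ⟨h1, h2⟩ := near_of_div_succ hLk e
    generalize hN : (ℓ + 1) ^ k = N at h1 h2 hz1 hz2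
    constructor <;> omega
  · have e : (x ν).val / (ℓ + 1) ^ k = (z ν).val / (ℓ + 1) ^ k := by
      rw [qunshift_apply_ne _ hν] at h'
      have h'' := congrArg ZMod.val h'
      rwa [hxq, hzq] at h''
    obtain ⟨h1, h2⟩ := near_of_div_eq hLk e
    generalize hN : (ℓ + 1) ^ k = N at h1 h2 hz1 hz2
    constructor <;> omega

/-- **THE LEVEL CHART INTERTWINES `y ↦ y − e_μ`** wherever the global block label does not wrap. [cite: Balaban1984PropagatorsII, p.238, dictionary] -/
theorem eSj_unshift_of_val {k : ℕ} {y : Site (PV d ℓ m K hd hL) k} {μ : Fin (d + 1)} (hv : ((y.unshift μ) μ).val + 1 = (y μ).val) :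
    eSj t x₀ k (y.unshift μ) = (eSj t x₀ k y).unshift μ := by
  funext ν
  by_cases hν : ν = μ
  · subst hν
    have hR : ((eSj t x₀ k y).unshift ν) ν = eSj t x₀ k y ν - 1 := by simp [Site.unshift]
    rw [hR]
    show ((((((y.unshift ν) ν).val : ℤ) - x₀ ν / (((ℓ + 1) ^ k : ℕ) : ℤ) : ℤ)) : ZMod (t.P.sitesPerDir k)) =
      ((((y ν).val : ℤ) - x₀ ν / (((ℓ + 1) ^ k : ℕ) : ℤ) : ℤ) : ZMod (t.P.sitesPerDir k)) - 1
    have : ((y ν).val : ℤ) = ((y.unshift ν) ν).val + 1 := by exact_mod_cast hv.symm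
    rw [this]; push_cast; ring
  · have hR : ((eSj t x₀ k y).unshift μ) ν = eSj t x₀ k y ν := by simp [Site.unshift, Function.update_of_ne hν]
    rw [hR]
    show ((((((y.unshift μ) ν).val : ℤ) - x₀ ν / (((ℓ + 1) ^ k : ℕ) : ℤ) : ℤ)) : ZMod (t.P.sitesPerDir k)) =
      ((((y ν).val : ℤ) - x₀ ν / (((ℓ + 1) ^ k : ℕ) : ℤ) : ℤ) : ZMod (t.P.sitesPerDir k))
    rw [qunshift_apply_ne y hν]

/-- **NEAR ⇒ DEEP (global torus)**: if `(Q_kδ_{b₁})(β) ≠ 0` for a fine bond `b₁` of margin `r + 2L^k`, every site of the block `B^k(β₋)` has margin `r`.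
[cite: Balaban1984PropagatorsI, (1.8) p.19, (1.18) p.20; Balaban1984PropagatorsII, p.238–239, dictionary] -/
theorem deep_block_of_near {k : ℕ} (hk : k ≤ m + K) (hx₀ : ∀ μ, 0 ≤ x₀ μ) {b₁ : PBond (PV d ℓ m K hd hL) 0} {β : PBond (PV d ℓ m K hd hL) k}
    {r : ℕ} (hb₁ : b₁ ∈ DeepB t x₀ (r + 2 * (ℓ + 1) ^ k)) (h : bondAvgIter k (Pi.single b₁ (1 : ℝ)) β ≠ 0) :
    ∀ x, iterBlockOf k x = β.src → x ∈ DeepS t x₀ r := by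
  obtain ⟨h1, -⟩ := blocks_of_bondAvgIter_single_ne_zero hk h
  intro x hx
  rcases h1 with e | e
  · exact deepS_of_iterBlockOf_eq hk (hx.trans e.symm) (deepS_mono (by omega) hb₁)
  · have e' : β.src = (iterBlockOf k b₁.src).unshift β.dir := by
      rw [e]; exact (qunshift_shift β.src β.dir).symm
    exact deepS_of_iterBlockOf_unshift hk hx₀ (hx.trans e') hb₁

/-- **NEAR ⇒ CHARTED AND DEEP (member torus)**: if the member's `(Q_kδ_{e b₁})(β′) ≠ 0` for a fine bond `b₁` of margin `r + 2L^k`, then `β′ = e_k β` for a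
global `k`-bond `β` all of whose block sites have margin `r` (the member torus does not wrap near `e b₁`). [cite: Balaban1984PropagatorsII, p.238 (T_□ = □̃³ with periodicity conditions), (2.89) p.239, dictionary] -/
theorem charted_of_member_near {k : ℕ} (hk : k ≤ m + K) (hkt : k ≤ t.m + t.K) (hdiv : ∀ μ, ((((ℓ + 1) ^ k : ℕ) : ℤ)) ∣ x₀ μ)
    (hx₀ : ∀ μ, 0 ≤ x₀ μ) {b₁ : PBond (PV d ℓ m K hd hL) 0} {β' : PBond t.P k} {r : ℕ} (hb₁ : b₁ ∈ DeepB t x₀ (r + 2 * (ℓ + 1) ^ k))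
    (h : bondAvgIter k (Pi.single (eB t x₀ b₁) (1 : ℝ)) β' ≠ 0) :
    ∃ β : PBond (PV d ℓ m K hd hL) k, eBj t x₀ k β = β' ∧ ∀ x, iterBlockOf k x = β.src → x ∈ DeepS t x₀ r := by
  obtain ⟨h1, -⟩ := blocks_of_bondAvgIter_single_ne_zero hkt h
  have hb₀ : b₁.src ∈ DeepS t x₀ 0 := deepS_mono (Nat.zero_le _) hb₁
  have hc : iterBlockOf k (eB t x₀ b₁).src = eSj t x₀ k (iterBlockOf k b₁.src) := iterBlockOf_eS hk hkt hdiv hb₀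
  rw [hc] at h1
  rcases h1 with e | e
  · refine ⟨⟨iterBlockOf k b₁.src, β'.dir⟩, ?_, fun x hx => ?_⟩
    · cases β'; simp only [eBj] at e ⊢; rw [e]
    · exact deepS_of_iterBlockOf_eq hk hx (deepS_mono (by omega) hb₁)
  · have hzv : 1 ≤ ((iterBlockOf k b₁.src) β'.dir).val := one_le_blockLabel hk hx₀ hb₁ β'.dir
    have hv : (((iterBlockOf k b₁.src).unshift β'.dir) β'.dir).val + 1 = ((iterBlockOf k b₁.src) β'.dir).val := by
      rw [qval_unshift_self (P := PV d ℓ m K hd hL) (iterBlockOf k b₁.src) β'.dir hzv]; omega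
    refine ⟨⟨(iterBlockOf k b₁.src).unshift β'.dir, β'.dir⟩, ?_, fun x hx => ?_⟩
    · have e' : β'.src = (eSj t x₀ k (iterBlockOf k b₁.src)).unshift β'.dir := by
        rw [e]; exact (qunshift_shift β'.src β'.dir).symm
      cases β'
      simp only [eBj] at e' ⊢
      rw [eSj_unshift_of_val hv, ← e']
    · exact deepS_of_iterBlockOf_unshift hk hx₀ hx hb₁

/-- a deep block is a window block: its level-`k` labels lie in `[x₀/L^k, x₀/L^k + N′_k)`. [cite: Balaban1984PropagatorsII, p.238, dictionary] -/
theorem window_of_deep_block {k : ℕ} (hk : k ≤ m + K) (hkt : k ≤ t.m + t.K) (hdiv : ∀ μ, ((((ℓ + 1) ^ k : ℕ) : ℤ)) ∣ x₀ μ)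
    {y : Site (PV d ℓ m K hd hL) k} {r : ℕ} (hy : ∀ x, iterBlockOf k x = y → x ∈ DeepS t x₀ r) (μ : Fin (d + 1)) :
    x₀ μ / (((ℓ + 1) ^ k : ℕ) : ℤ) ≤ ((y μ).val : ℤ) ∧ ((y μ).val : ℤ) < x₀ μ / (((ℓ + 1) ^ k : ℕ) : ℤ) + (t.P.sitesPerDir k : ℕ) := by
  obtain ⟨x₁, hx₁⟩ := iterBlock_nonempty (P := PV d ℓ m K hd hL) hk y
  rw [mem_iterBlock] at hx₁
  have hw := iterBlockOf_window hk hkt hdiv (deepS_mono (Nat.zero_le _) (hy x₁ hx₁)) μ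
  rwa [hx₁] at hw

end NearDeep

/-! ## §7  THE AVERAGING HALF OF `hagree`: `Q*aQ` OF `T_η`, CUT OFF NEAR `□`, IS THE TRANSPLANTED `Q*aQ` OF `T_□`
(weights `w = s·w_□` on corresponding index bonds, (2.89)) -/

section Sandwich

open B6SectAOperatorsV1 (QE aE QsE BondIdx)
open B6SectADomainsV1 (Domains)
open B6SectCTwoScaleV1 (OutBond InBond CIdx)
open B6SectAOntoV1 (bondAvgIterLin)

/-! ### Point masses through the chart, and the index sum of `𝔅 = ⊔_j Λ_j` level by level -/

/-- the chart reads a point mass on a window point as the point mass at its image: `ρ δ_x = δ_{e x}`. [cite: Balaban1984PropagatorsII, p.238 (T_□), dictionary] -/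
theorem restrictOp_single {X X' : Type} [DecidableEq X] [DecidableEq X'] (W : Finset X) (e : X → X') {x : X} (hx : x ∈ W) :
    restrictOp W e (Pi.single x (1 : ℝ)) = Pi.single (e x) (1 : ℝ) := by
  funext x'
  rw [restrictOp_apply]
  by_cases h : e x = x'
  · rw [Finset.sum_eq_single_of_mem x (Finset.mem_filter.2 ⟨hx, h⟩) (fun y _ hy => by rw [Pi.single_apply, if_neg hy]),
      Pi.single_eq_same, ← h, Pi.single_eq_same]
  · rw [Finset.sum_eq_zero (fun y hy => ?_), Pi.single_apply, if_neg (Ne.symm h)]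
    rw [Pi.single_apply, if_neg]
    rintro rfl
    exact h (Finset.mem_filter.1 hy).2

/-- … and a point mass off the window as `0`. [cite: Balaban1984PropagatorsII, p.238 (T_□), dictionary] -/
theorem restrictOp_single_of_not_mem {X X' : Type} [DecidableEq X] [DecidableEq X'] (W : Finset X) (e : X → X') {x : X} (hx : x ∉ W) :
    restrictOp W e (Pi.single x (1 : ℝ)) = 0 := by
  funext x'
  rw [restrictOp_apply, Pi.zero_apply]
  refine Finset.sum_eq_zero fun y hy => ?_
  rw [Pi.single_apply, if_neg]
  rintro rfl
  exact hx (Finset.mem_filter.1 hy).1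

/-- the weights `w : 𝔅 → ℝ` of the multi-scale `a` (2.18) read level by level on ALL `n`-bonds (zero off `Λ_n` and beyond level `k`). [cite: Balaban1984PropagatorsII, (2.18)–(2.20) p.226, dictionary] -/
def wxG {P : Params} (Dm : Domains P) (wG : BondIdx Dm → ℝ) (n : ℕ) (β : PBond P n) : ℝ :=
  if h : n < Dm.k + 1 ∧ Dm.LamBond n β then wG ⟨⟨⟨n, h.1⟩, β⟩, h.2⟩ else 0

/-- on an index bond the level reading is the weight. [cite: Balaban1984PropagatorsII, (2.18)–(2.20) p.226, dictionary] -/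
theorem wxG_idx {P : Params} (Dm : Domains P) (wG : BondIdx Dm → ℝ) (i : BondIdx Dm) : wxG Dm wG i.1.1 i.1.2 = wG i := by
  obtain ⟨⟨j'', β⟩, hβ⟩ := i
  exact dif_pos ⟨j''.isLt, hβ⟩

/-- off `Λ_n` the level reading vanishes. [cite: Balaban1984PropagatorsII, (2.18)–(2.20) p.226, dictionary] -/
theorem wxG_of_not_lam {P : Params} (Dm : Domains P) (wG : BondIdx Dm → ℝ) {n : ℕ} {β : PBond P n} (h : ¬ Dm.LamBond n β) :
    wxG Dm wG n β = 0 :=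
  dif_neg fun h' => h h'.2

/-- on `Λ_n`, `n ≤ k`, the level reading is the weight of the index bond. [cite: Balaban1984PropagatorsII, (2.18)–(2.20) p.226, dictionary] -/
theorem wxG_of_lam {P : Params} (Dm : Domains P) (wG : BondIdx Dm → ℝ) {n : ℕ} {β : PBond P n} (hn : n < Dm.k + 1) (h : Dm.LamBond n β) :
    wxG Dm wG n β = wG ⟨⟨⟨n, hn⟩, β⟩, h⟩ :=
  dif_pos ⟨hn, h⟩

/-- **THE INDEX SUM OVER `𝔅 = ⊔_{j ≤ k} Λ_j` LEVEL BY LEVEL**: `Σ_{i ∈ 𝔅} g(i, w_i) = Σ_{n ≤ k} Σ_{β ∈ T^{(n)}-bonds} g(β, w̃_n(β))` for a summand vanishing at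
weight `0`. [cite: Balaban1984PropagatorsII, (2.3) p.224 (𝔅 = ⋃_j Λ_j), (2.20) p.226, dictionary] -/
theorem sum_bondIdx_levels {P : Params} (Dm : Domains P) (wG : BondIdx Dm → ℝ) (g : (n : ℕ) → PBond P n → ℝ → ℝ)
    (hg : ∀ n β, g n β 0 = 0) :
    ∑ i : BondIdx Dm, g i.1.1 i.1.2 (wG i) = ∑ n ∈ Finset.range (Dm.k + 1), ∑ β : PBond P n, g n β (wxG Dm wG n β) := by
  classical
  have h1 : ∑ i : BondIdx Dm, g i.1.1 i.1.2 (wG i) =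
      ∑ i : BondIdx Dm, (fun p : (j : Fin (Dm.k + 1)) × PBond P j => g p.1 p.2 (wxG Dm wG p.1 p.2)) i.1 :=
    Finset.sum_congr rfl fun i _ => by simp only [wxG_idx]
  have h2 : ∑ p ∈ Finset.univ.filter (fun p : (j : Fin (Dm.k + 1)) × PBond P j => Dm.LamBond p.1 p.2),
      (fun p : (j : Fin (Dm.k + 1)) × PBond P j => g p.1 p.2 (wxG Dm wG p.1 p.2)) p =
      ∑ i : BondIdx Dm, (fun p : (j : Fin (Dm.k + 1)) × PBond P j => g p.1 p.2 (wxG Dm wG p.1 p.2)) i.1 :=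
    Finset.sum_subtype _ (fun p => by simp) _
  rw [h1, ← h2, Finset.sum_filter_of_ne, Fintype.sum_sigma, Finset.sum_fin_eq_sum_range]
  · refine Finset.sum_congr rfl fun n hn => ?_
    rw [dif_pos (Finset.mem_range.1 hn)]
  · intro p _ hne
    by_contra hL
    exact hne (by simp only [wxG_of_not_lam Dm wG hL, hg])

variable {t : TSIdx d (ℓ + 1) hd hL a₀ a₁} {x₀ : Fin (d + 1) → ℤ}
variable {hx₀ : ∀ μ, 0 ≤ x₀ μ} {hfit : ∀ μ, x₀ μ + (t.P.sitesPerDir 0 : ℕ) ≤ ((PV d ℓ m K hd hL).sitesPerDir 0 : ℕ)}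

/-! ### The kernel of `Q_k` through the chart -/

/-- **THE ENTRIES OF `Q_k` THROUGH THE CHART**: for a `k`-bond `β` whose block keeps the margin `L^k`, `(Q_kδ_b)(β) = (Q_kδ_{e b})(e_k β)` for window
bonds `b` and `= 0` for bonds off the window. [cite: Balaban1984PropagatorsI, (1.18) p.20; Balaban1984PropagatorsII, (2.20) p.226, p.238–239 (Q on T_□), dictionary] -/
theorem bondAvgIter_single_chart {k : ℕ} (hk : k ≤ m + K) (hkt : k ≤ t.m + t.K) (hdiv : ∀ μ, ((((ℓ + 1) ^ k : ℕ) : ℤ)) ∣ x₀ μ)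
    (β : PBond (PV d ℓ m K hd hL) k) (hβ : ∀ x, iterBlockOf k x = β.src → x ∈ DeepS t x₀ ((ℓ + 1) ^ k)) (b : PBond (PV d ℓ m K hd hL) 0) :
    bondAvgIter k (Pi.single b (1 : ℝ)) β =
      if b ∈ (cB t x₀ hx₀ hfit).W then bondAvgIter k (Pi.single (eB t x₀ b) (1 : ℝ)) (eBj t x₀ k β) else 0 := by
  classical
  rw [← bondAvgIter_chart (hx₀ := hx₀) (hfit := hfit) hk hkt hdiv β hβ (Pi.single b 1)]
  split_ifs with hb
  · rw [restrictOp_single _ _ hb]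
  · rw [restrictOp_single_of_not_mem _ _ hb]
    exact congrFun ((bondAvgIterLin t.P ℝ k).map_zero) _

variable (t x₀) in
/-- **NEARNESS**: the `k`-bond `β` of `T_η` SEES the deep region of margin `r` of the window — its average `(Q_kδ_{b₁})(β)` is non-zero for some
fine bond `b₁` of margin `r` (only such index bonds enter `M·h_□` for `h_□` supported at margin `r`). [cite: Balaban1984PropagatorsII, (2.89)–(2.91) p.239, dictionary] -/
def NearB (r k : ℕ) (β : PBond (PV d ℓ m K hd hL) k) : Prop :=
  ∃ b₁ ∈ DeepB t x₀ r, bondAvgIter k (Pi.single b₁ (1 : ℝ)) β ≠ 0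

/-! ### One level through the chart -/

/-- **ONE LEVEL OF THE SANDWICH THROUGH THE CHART**: for a deep fine bond `b₁` (margin `3L^k`) and any fine bond `b`, the level-`k` sum
`Σ_β (Q_kδ_b)(β)·w̃(β)·(Q_kδ_{b₁})(β)` over ALL `k`-bonds of `T_η`, with a weight `w̃` that vanishes on near bonds not charted into the member's
index set `Out′` and equals `s·w′(e_kβ)` on near bonds charted into it, IS `s·[b ∈ window]·Σ_{β′ ∈ Out′} (Q_kδ_{eb})(β′)·w′(β′)·(Q_kδ_{eb₁})(β′)`
(a bijection of the non-zero summands: near ⇒ deep ⇒ charted; member-near ⇒ charted, `charted_of_member_near`).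
[cite: Balaban1984PropagatorsII, (2.89)–(2.90) p.239, (2.97) p.240, dictionary] -/
theorem level_sum_chart {k : ℕ} (hk : k ≤ m + K) (hkt : k ≤ t.m + t.K) (hdiv : ∀ μ, ((((ℓ + 1) ^ k : ℕ) : ℤ)) ∣ x₀ μ)
    {b₁ : PBond (PV d ℓ m K hd hL) 0} (hb₁ : b₁ ∈ DeepB t x₀ ((ℓ + 1) ^ k + 2 * (ℓ + 1) ^ k)) (b : PBond (PV d ℓ m K hd hL) 0)
    (Out' : PBond t.P k → Prop) [DecidablePred Out'] (w' : {β' // Out' β'} → ℝ) (wx : PBond (PV d ℓ m K hd hL) k → ℝ) (s : ℝ)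
    (hz : ∀ β, bondAvgIter k (Pi.single b₁ (1 : ℝ)) β ≠ 0 → ¬ Out' (eBj t x₀ k β) → wx β = 0)
    (hw : ∀ β (h' : Out' (eBj t x₀ k β)), bondAvgIter k (Pi.single b₁ (1 : ℝ)) β ≠ 0 → wx β = s * w' ⟨eBj t x₀ k β, h'⟩) :
    ∑ β : PBond (PV d ℓ m K hd hL) k, bondAvgIter k (Pi.single b (1 : ℝ)) β * (wx β * bondAvgIter k (Pi.single b₁ (1 : ℝ)) β) =
      s * ((if b ∈ (cB t x₀ hx₀ hfit).W then (1 : ℝ) else 0) *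
        ∑ β' : {β' // Out' β'}, bondAvgIter k (Pi.single (eB t x₀ b) (1 : ℝ)) β'.1 *
          (w' β' * bondAvgIter k (Pi.single (eB t x₀ b₁) (1 : ℝ)) β'.1)) := by
  classical
  have hb₁W : b₁ ∈ (cB t x₀ hx₀ hfit).W := mem_cB_W.2 (deepS_mono (Nat.zero_le _) hb₁)
  -- the member weight read on all `k`-bonds of `T_□`
  set wx' : PBond t.P k → ℝ := fun β' => if h : Out' β' then w' ⟨β', h⟩ else 0 with hwx'
  have wx'_pos : ∀ β' (h : Out' β'), wx' β' = w' ⟨β', h⟩ := fun β' h => by simp only [hwx', dif_pos h]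
  have wx'_neg : ∀ β', ¬ Out' β' → wx' β' = 0 := fun β' h => by simp only [hwx', dif_neg h]
  have hM : ∑ β' : {β' // Out' β'}, bondAvgIter k (Pi.single (eB t x₀ b) (1 : ℝ)) β'.1 *
        (w' β' * bondAvgIter k (Pi.single (eB t x₀ b₁) (1 : ℝ)) β'.1) =
      ∑ β' : PBond t.P k, bondAvgIter k (Pi.single (eB t x₀ b) (1 : ℝ)) β' * (wx' β' * bondAvgIter k (Pi.single (eB t x₀ b₁) (1 : ℝ)) β') := by
    have h2 : ∑ β' ∈ Finset.univ.filter Out', bondAvgIter k (Pi.single (eB t x₀ b) (1 : ℝ)) β' *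
          (wx' β' * bondAvgIter k (Pi.single (eB t x₀ b₁) (1 : ℝ)) β') =
        ∑ β' : {β' // Out' β'}, bondAvgIter k (Pi.single (eB t x₀ b) (1 : ℝ)) β'.1 *
          (wx' β'.1 * bondAvgIter k (Pi.single (eB t x₀ b₁) (1 : ℝ)) β'.1) :=
      Finset.sum_subtype _ (fun β' => by simp) _
    rw [← Finset.sum_filter_of_ne (s := Finset.univ) (p := Out') (fun β' _ hne => ?_), h2]
    · refine Finset.sum_congr rfl fun β' _ => ?_
      rw [wx'_pos _ β'.2]
    · by_contra hO
      apply hne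
      rw [wx'_neg _ hO, zero_mul, mul_zero]
  rw [hM, Finset.mul_sum, Finset.mul_sum]
  -- what a non-zero global summand forces
  have key : ∀ β : PBond (PV d ℓ m K hd hL) k, bondAvgIter k (Pi.single b (1 : ℝ)) β * (wx β * bondAvgIter k (Pi.single b₁ (1 : ℝ)) β) ≠ 0 →
      bondAvgIter k (Pi.single b₁ (1 : ℝ)) β ≠ 0 ∧ (∀ x, iterBlockOf k x = β.src → x ∈ DeepS t x₀ ((ℓ + 1) ^ k)) ∧ Out' (eBj t x₀ k β) := by
    intro β hne
    have hc : bondAvgIter k (Pi.single b₁ (1 : ℝ)) β ≠ 0 := right_ne_zero_of_mul (right_ne_zero_of_mul hne)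
    have hwne : wx β ≠ 0 := left_ne_zero_of_mul (right_ne_zero_of_mul hne)
    refine ⟨hc, deep_block_of_near hk hx₀ hb₁ hc, ?_⟩
    by_contra hO
    exact hwne (hz β hc hO)
  refine Finset.sum_bij_ne_zero (fun β _ _ => eBj t x₀ k β) (fun _ _ _ => Finset.mem_univ _) (fun β₁' h₁ hne₁ β₂' h₂ hne₂ e => ?_)
    (fun β' _ hne => ?_) (fun β _ hne => ?_)
  · -- injective on the near bonds (their blocks are window blocks)
    obtain ⟨-, hd₁, -⟩ := key β₁' hne₁
    obtain ⟨-, hd₂, -⟩ := key β₂' hne₂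
    have hw₁ := window_of_deep_block hk hkt hdiv hd₁
    have hw₂ := window_of_deep_block hk hkt hdiv hd₂
    cases β₁'
    cases β₂'
    simp only [eBj, PBond.mk.injEq] at e ⊢
    exact ⟨eSj_inj hw₁ hw₂ e.1, e.2⟩
  · -- onto the non-zero member summands
    have hs : s ≠ 0 := left_ne_zero_of_mul hne
    have hχ : (if b ∈ (cB t x₀ hx₀ hfit).W then (1 : ℝ) else 0) ≠ 0 := left_ne_zero_of_mul (right_ne_zero_of_mul hne)
    have hbW : b ∈ (cB t x₀ hx₀ hfit).W := by by_contra h; exact hχ (if_neg h)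
    have hM' := right_ne_zero_of_mul (right_ne_zero_of_mul hne)
    have hQb : bondAvgIter k (Pi.single (eB t x₀ b) (1 : ℝ)) β' ≠ 0 := left_ne_zero_of_mul hM'
    have hw'ne : wx' β' ≠ 0 := left_ne_zero_of_mul (right_ne_zero_of_mul hM')
    have hQb₁ : bondAvgIter k (Pi.single (eB t x₀ b₁) (1 : ℝ)) β' ≠ 0 := right_ne_zero_of_mul (right_ne_zero_of_mul hM')
    have hO : Out' β' := by by_contra h; exact hw'ne (wx'_neg _ h)
    obtain ⟨β, hββ', hdeep⟩ := charted_of_member_near hk hkt hdiv hx₀ hb₁ hQb₁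
    subst hββ'
    have hglob₁ : bondAvgIter k (Pi.single b₁ (1 : ℝ)) β ≠ 0 := by
      rw [bondAvgIter_single_chart (hx₀ := hx₀) (hfit := hfit) hk hkt hdiv β hdeep b₁, if_pos hb₁W]; exact hQb₁
    refine ⟨β, Finset.mem_univ _, ?_, rfl⟩
    rw [bondAvgIter_single_chart (hx₀ := hx₀) (hfit := hfit) hk hkt hdiv β hdeep b, if_pos hbW, hw β hO hglob₁]
    refine mul_ne_zero hQb (mul_ne_zero (mul_ne_zero hs ?_) hglob₁)
    rw [wx'_pos _ hO] at hw'ne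
    exact hw'ne
  · -- the summands agree
    obtain ⟨hc, hdeep, hO⟩ := key β hne
    rw [bondAvgIter_single_chart (hx₀ := hx₀) (hfit := hfit) hk hkt hdiv β hdeep b,
      bondAvgIter_single_chart (hx₀ := hx₀) (hfit := hfit) hk hkt hdiv β hdeep b₁, if_pos hb₁W, hw β hO hc, wx'_pos _ hO]
    split_ifs <;> ring

/-! ### The sandwich `Q*aQ` through the charts -/

/-- **`Q*aQ` OF `T_η`, ON INPUTS OF MARGIN `3L^{j+1}`, IS `s` TIMES THE TRANSPLANTED `Q*aQ` OF `T_□`** — the typed content of (2.89):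
*"we take Q*aQ equal to Q_{j+1}a_{j+1}Q_{j+1} on B^j(Λ′), and to Q_j*a_jQ_j on T_□ ∖ B^j(Λ′)"*, `B^j(Λ′) = □̃² ∩ B^{j+1}(Λ_{j+1})`.  HYPOTHESES
(the correspondence of the index sets near `□`, discharged from the cube geometry in (d5)): near the deep region only the levels `j`, `j + 1` of
`𝔅` are seen (`hL0`); a near `j`-bond is in `Λ_j` iff its chart is a `Λ^c`-bond of `T_□` (`hLj`); a near `(j+1)`-bond is in `Λ_{j+1}` iff its chart
is a `Λ′`-bond (`hLj1`); and the weights correspond, `w = s·w_□` (`hWj`, `hWj1`; `s = (c′/c)²` carries the units, the averages carry none).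
[cite: Balaban1984PropagatorsII, (2.89)–(2.90) p.239, (2.18)–(2.20) p.226, (2.97) p.240] -/
theorem kagree_QaQ (Dm : Domains (PV d ℓ m K hd hL)) (wG : BondIdx Dm → ℝ) (s : ℝ) {r : ℕ}
    (hjm : t.j + 1 ≤ m + K) (hdiv : ∀ μ, ((((ℓ + 1) ^ (t.j + 1) : ℕ) : ℤ)) ∣ x₀ μ) (hr : 3 * (ℓ + 1) ^ (t.j + 1) ≤ r)
    (hL0 : ∀ i : BondIdx Dm, (i.1.1 : ℕ) ≠ t.j → (i.1.1 : ℕ) ≠ t.j + 1 → ¬ NearB t x₀ r i.1.1 i.1.2)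
    (hLj : ∀ β : PBond (PV d ℓ m K hd hL) t.j, NearB t x₀ r t.j β →
      (Dm.LamBond t.j β ↔ (blockOf (eBj t x₀ t.j β).src ∉ t.Λ' ∧ blockOf (eBj t x₀ t.j β).tgt ∉ t.Λ')))
    (hLj1 : ∀ η : PBond (PV d ℓ m K hd hL) (t.j + 1), NearB t x₀ r (t.j + 1) η →
      (Dm.LamBond (t.j + 1) η ↔ ((eBj t x₀ (t.j + 1) η).src ∈ t.Λ' ∨ (eBj t x₀ (t.j + 1) η).tgt ∈ t.Λ')))
    (hWj : ∀ (hlt : t.j < Dm.k + 1) (β : PBond (PV d ℓ m K hd hL) t.j) (hβ : Dm.LamBond t.j β)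
      (hβ' : blockOf (eBj t x₀ t.j β).src ∉ t.Λ' ∧ blockOf (eBj t x₀ t.j β).tgt ∉ t.Λ'), NearB t x₀ r t.j β →
      wG ⟨⟨⟨t.j, hlt⟩, β⟩, hβ⟩ = s * t.w (Sum.inl ⟨eBj t x₀ t.j β, hβ'⟩))
    (hWj1 : ∀ (hlt : t.j + 1 < Dm.k + 1) (η : PBond (PV d ℓ m K hd hL) (t.j + 1)) (hη : Dm.LamBond (t.j + 1) η)
      (hη' : (eBj t x₀ (t.j + 1) η).src ∈ t.Λ' ∨ (eBj t x₀ (t.j + 1) η).tgt ∈ t.Λ'), NearB t x₀ r (t.j + 1) η →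
      wG ⟨⟨⟨t.j + 1, hlt⟩, η⟩, hη⟩ = s * t.w (Sum.inr ⟨eBj t x₀ (t.j + 1) η, hη'⟩)) :
    KAgree (cB t x₀ hx₀ hfit) (cB t x₀ hx₀ hfit) s (onFun (QsE Dm ∘ₗ aE Dm wG ∘ₗ QE Dm))
      (onFun (LinearMap.adjoint t.D.Q ∘ₗ t.D.a ∘ₗ t.D.Q)) (DeepB t x₀ r) := by
  classical
  intro b₁ hb₁ b
  have hjm' : t.j ≤ m + K := by omega
  have hjt : t.j ≤ t.m + t.K := by have := t.hj; omega
  have hdivj : ∀ μ, ((((ℓ + 1) ^ t.j : ℕ) : ℤ)) ∣ x₀ μ := fun μ =>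
    (Int.natCast_dvd_natCast.2 (pow_dvd_pow (ℓ + 1) (Nat.le_succ t.j))).trans (hdiv μ)
  have hpow : (ℓ + 1) ^ t.j ≤ (ℓ + 1) ^ (t.j + 1) := Nat.pow_le_pow_right (Nat.succ_pos ℓ) (Nat.le_succ _)
  have hb₁j : b₁ ∈ DeepB t x₀ ((ℓ + 1) ^ t.j + 2 * (ℓ + 1) ^ t.j) := deepS_mono (by omega) hb₁
  have hb₁j1 : b₁ ∈ DeepB t x₀ ((ℓ + 1) ^ (t.j + 1) + 2 * (ℓ + 1) ^ (t.j + 1)) := deepS_mono (by omega) hb₁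
  -- the member side: the sandwich kernel of `T_□` (or zero off the window)
  rw [toMatrix'_QaQ, show (cB t x₀ hx₀ hfit).e = eB t x₀ from rfl]
  have hmem : (if b ∈ (cB t x₀ hx₀ hfit).W then
        LinearMap.toMatrix' (onFun (LinearMap.adjoint t.D.Q ∘ₗ t.D.a ∘ₗ t.D.Q)) (eB t x₀ b) (eB t x₀ b₁) else 0) =
      (if b ∈ (cB t x₀ hx₀ hfit).W then (1 : ℝ) else 0) *
        ((∑ β' : OutBond t.j t.Λ', bondAvgIter t.j (Pi.single (eB t x₀ b) (1 : ℝ)) β'.1 *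
            (t.w (Sum.inl β') * bondAvgIter t.j (Pi.single (eB t x₀ b₁) (1 : ℝ)) β'.1)) +
          ∑ η' : InBond t.j t.Λ', bondAvgIter (t.j + 1) (Pi.single (eB t x₀ b) (1 : ℝ)) η'.1 *
            (t.w (Sum.inr η') * bondAvgIter (t.j + 1) (Pi.single (eB t x₀ b₁) (1 : ℝ)) η'.1)) := by
    split_ifs with hb
    · rw [one_mul, toMatrix'_memberQaQ]
    · rw [zero_mul]
  rw [hmem]
  -- the global side level by level; only the levels `j`, `j + 1` are seen from the deep region
  rw [sum_bondIdx_levels Dm wG (fun n β w => bondAvgIter n (Pi.single b (1 : ℝ)) β * (w * bondAvgIter n (Pi.single b₁ (1 : ℝ)) β))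
    (fun n β => by rw [zero_mul, mul_zero])]
  have h0 : ∀ n ∈ Finset.range (Dm.k + 1), n ≠ t.j ∧ n ≠ t.j + 1 →
      ∑ β : PBond (PV d ℓ m K hd hL) n, bondAvgIter n (Pi.single b (1 : ℝ)) β * (wxG Dm wG n β * bondAvgIter n (Pi.single b₁ (1 : ℝ)) β) = 0 := by
    intro n _ hn
    refine Finset.sum_eq_zero fun β _ => ?_
    by_contra hne
    have hc : bondAvgIter n (Pi.single b₁ (1 : ℝ)) β ≠ 0 := right_ne_zero_of_mul (right_ne_zero_of_mul hne)
    have hwne : wxG Dm wG n β ≠ 0 := left_ne_zero_of_mul (right_ne_zero_of_mul hne)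
    by_cases hlam : n < Dm.k + 1 ∧ Dm.LamBond n β
    · exact hL0 ⟨⟨⟨n, hlam.1⟩, β⟩, hlam.2⟩ hn.1 hn.2 ⟨b₁, hb₁, hc⟩
    · exact hwne (dif_neg hlam)
  have hoff : ∀ n, n ∉ Finset.range (Dm.k + 1) →
      ∑ β : PBond (PV d ℓ m K hd hL) n, bondAvgIter n (Pi.single b (1 : ℝ)) β * (wxG Dm wG n β * bondAvgIter n (Pi.single b₁ (1 : ℝ)) β) = 0 := by
    intro n hn
    refine Finset.sum_eq_zero fun β _ => ?_
    have : wxG Dm wG n β = 0 := dif_neg fun h => hn (Finset.mem_range.2 h.1)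
    rw [this, zero_mul, mul_zero]
  rw [Finset.sum_eq_add t.j (t.j + 1) (by omega) h0 (hoff t.j) (hoff (t.j + 1))]
  -- the two levels through the chart
  have hzj : ∀ β : PBond (PV d ℓ m K hd hL) t.j, bondAvgIter t.j (Pi.single b₁ (1 : ℝ)) β ≠ 0 →
      ¬ (blockOf (eBj t x₀ t.j β).src ∉ t.Λ' ∧ blockOf (eBj t x₀ t.j β).tgt ∉ t.Λ') → wxG Dm wG t.j β = 0 := by
    intro β hc hO
    by_cases hlam : t.j < Dm.k + 1 ∧ Dm.LamBond t.j β
    · exact absurd ((hLj β ⟨b₁, hb₁, hc⟩).1 hlam.2) hO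
    · exact dif_neg hlam
  have hwj : ∀ (β : PBond (PV d ℓ m K hd hL) t.j) (h' : blockOf (eBj t x₀ t.j β).src ∉ t.Λ' ∧ blockOf (eBj t x₀ t.j β).tgt ∉ t.Λ'),
      bondAvgIter t.j (Pi.single b₁ (1 : ℝ)) β ≠ 0 → wxG Dm wG t.j β = s * t.w (Sum.inl ⟨eBj t x₀ t.j β, h'⟩) := by
    intro β h' hc
    have hlam : Dm.LamBond t.j β := (hLj β ⟨b₁, hb₁, hc⟩).2 h'
    have hlt : t.j < Dm.k + 1 := Nat.lt_succ_of_le (Dm.le_of_lamBond hlam)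
    rw [wxG_of_lam Dm wG hlt hlam]
    exact hWj hlt β hlam h' ⟨b₁, hb₁, hc⟩
  have hzj1 : ∀ η : PBond (PV d ℓ m K hd hL) (t.j + 1), bondAvgIter (t.j + 1) (Pi.single b₁ (1 : ℝ)) η ≠ 0 →
      ¬ ((eBj t x₀ (t.j + 1) η).src ∈ t.Λ' ∨ (eBj t x₀ (t.j + 1) η).tgt ∈ t.Λ') → wxG Dm wG (t.j + 1) η = 0 := by
    intro η hc hO
    by_cases hlam : t.j + 1 < Dm.k + 1 ∧ Dm.LamBond (t.j + 1) η
    · exact absurd ((hLj1 η ⟨b₁, hb₁, hc⟩).1 hlam.2) hO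
    · exact dif_neg hlam
  have hwj1 : ∀ (η : PBond (PV d ℓ m K hd hL) (t.j + 1)) (h' : (eBj t x₀ (t.j + 1) η).src ∈ t.Λ' ∨ (eBj t x₀ (t.j + 1) η).tgt ∈ t.Λ'),
      bondAvgIter (t.j + 1) (Pi.single b₁ (1 : ℝ)) η ≠ 0 → wxG Dm wG (t.j + 1) η = s * t.w (Sum.inr ⟨eBj t x₀ (t.j + 1) η, h'⟩) := by
    intro η h' hc
    have hlam : Dm.LamBond (t.j + 1) η := (hLj1 η ⟨b₁, hb₁, hc⟩).2 h'
    have hlt : t.j + 1 < Dm.k + 1 := Nat.lt_succ_of_le (Dm.le_of_lamBond hlam)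
    rw [wxG_of_lam Dm wG hlt hlam]
    exact hWj1 hlt η hlam h' ⟨b₁, hb₁, hc⟩
  have hlevj := level_sum_chart (hx₀ := hx₀) (hfit := hfit) hjm' hjt hdivj hb₁j b
    (fun β' : PBond t.P t.j => blockOf β'.src ∉ t.Λ' ∧ blockOf β'.tgt ∉ t.Λ') (fun β' => t.w (Sum.inl β')) (wxG Dm wG t.j) s hzj hwj
  have hlevj1 := level_sum_chart (hx₀ := hx₀) (hfit := hfit) hjm t.hj hdiv hb₁j1 b
    (fun η' : PBond t.P (t.j + 1) => η'.src ∈ t.Λ' ∨ η'.tgt ∈ t.Λ') (fun η' => t.w (Sum.inr η')) (wxG Dm wG (t.j + 1)) s hzj1 hwj1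
  rw [hlevj, hlevj1, ← mul_add, ← mul_add]

/-- **THE AVERAGING HALF OF `hagree`**: `Q*aQ·h = s•(ε(Q*aQ)_□ρ)·h` for every cut-off `h` supported at margin `3L^{j+1}` (same hypotheses).
[cite: Balaban1984PropagatorsII, (2.89)–(2.91) p.239] -/
theorem agree_QaQ (Dm : Domains (PV d ℓ m K hd hL)) (wG : BondIdx Dm → ℝ) (s : ℝ) {r : ℕ}
    (hjm : t.j + 1 ≤ m + K) (hdiv : ∀ μ, ((((ℓ + 1) ^ (t.j + 1) : ℕ) : ℤ)) ∣ x₀ μ) (hr : 3 * (ℓ + 1) ^ (t.j + 1) ≤ r)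
    (hL0 : ∀ i : BondIdx Dm, (i.1.1 : ℕ) ≠ t.j → (i.1.1 : ℕ) ≠ t.j + 1 → ¬ NearB t x₀ r i.1.1 i.1.2)
    (hLj : ∀ β : PBond (PV d ℓ m K hd hL) t.j, NearB t x₀ r t.j β →
      (Dm.LamBond t.j β ↔ (blockOf (eBj t x₀ t.j β).src ∉ t.Λ' ∧ blockOf (eBj t x₀ t.j β).tgt ∉ t.Λ')))
    (hLj1 : ∀ η : PBond (PV d ℓ m K hd hL) (t.j + 1), NearB t x₀ r (t.j + 1) η →
      (Dm.LamBond (t.j + 1) η ↔ ((eBj t x₀ (t.j + 1) η).src ∈ t.Λ' ∨ (eBj t x₀ (t.j + 1) η).tgt ∈ t.Λ')))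
    (hWj : ∀ (hlt : t.j < Dm.k + 1) (β : PBond (PV d ℓ m K hd hL) t.j) (hβ : Dm.LamBond t.j β)
      (hβ' : blockOf (eBj t x₀ t.j β).src ∉ t.Λ' ∧ blockOf (eBj t x₀ t.j β).tgt ∉ t.Λ'), NearB t x₀ r t.j β →
      wG ⟨⟨⟨t.j, hlt⟩, β⟩, hβ⟩ = s * t.w (Sum.inl ⟨eBj t x₀ t.j β, hβ'⟩))
    (hWj1 : ∀ (hlt : t.j + 1 < Dm.k + 1) (η : PBond (PV d ℓ m K hd hL) (t.j + 1)) (hη : Dm.LamBond (t.j + 1) η)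
      (hη' : (eBj t x₀ (t.j + 1) η).src ∈ t.Λ' ∨ (eBj t x₀ (t.j + 1) η).tgt ∈ t.Λ'), NearB t x₀ r (t.j + 1) η →
      wG ⟨⟨⟨t.j + 1, hlt⟩, η⟩, hη⟩ = s * t.w (Sum.inr ⟨eBj t x₀ (t.j + 1) η, hη'⟩))
    (h : PBond (PV d ℓ m K hd hL) 0 → ℝ) (hh : ∀ b, h b ≠ 0 → b ∈ DeepB t x₀ r) :
    onFun (QsE Dm ∘ₗ aE Dm wG ∘ₗ QE Dm) * mulOp h =
      s • (transplant (cB t x₀ hx₀ hfit).W (eB t x₀) (onFun (LinearMap.adjoint t.D.Q ∘ₗ t.D.a ∘ₗ t.D.Q)) * mulOp h) :=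
  (kagree_QaQ Dm wG s hjm hdiv hr hL0 hLj hLj1 hWj hWj1).mul_mulOp (fun _ hb => mem_cB_W.2 (deepS_mono (Nat.zero_le _) hb)) h hh

end Sandwich

/-! ## §8  `hagree` ASSEMBLED: the local part `M = Δ + Q*aQ` of the global `Δ_a` (the minuend of `deltaAE_split`), cut off near `□`, IS the
transplanted `M_□ = Δ_□ + (Q*aQ)_□` of the member (the `Ml` of `hinvl_GlV1`) — with the unit factor `(c′/L^j)²`, and literally for `c′ = L^j` -/

section HAgree

open B6SectAOperatorsV1 (dE dsE dcE dcsE QE aE QsE BondIdx)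
open B6SectADomainsV1 (Domains)

variable {t : TSIdx d (ℓ + 1) hd hL a₀ a₁} {x₀ : Fin (d + 1) → ℤ}
variable {hx₀ : ∀ μ, 0 ≤ x₀ μ} {hfit : ∀ μ, x₀ μ + (t.P.sitesPerDir 0 : ℕ) ≤ ((PV d ℓ m K hd hL).sitesPerDir 0 : ℕ)}

/-- **`M·h_□ = s•(εM_□ρ)·h_□` FOR THE FULL LOCAL PART `M = ∂*∂ + ∂∂* + Q*aQ`** (global fine factor `c′`, member factor `L^j`, `s = (c′/L^j)²`,
weights `w = s·w_□` on corresponding index bonds), for every cut-off `h_□` supported at margin `3L^{j+1}`: the `Δ`-half is `agree_lapV_member`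
of (d3-a), the averaging half `agree_QaQ`. [cite: Balaban1984PropagatorsII, (2.89)–(2.91) p.239, (2.94) p.239] -/
theorem hagree_member (Dm : Domains (PV d ℓ m K hd hL)) (wG : BondIdx Dm → ℝ) {c' : ℝ} (hc' : c' ≠ 0) {r : ℕ}
    (hjm : t.j + 1 ≤ m + K) (hdiv : ∀ μ, ((((ℓ + 1) ^ (t.j + 1) : ℕ) : ℤ)) ∣ x₀ μ) (hr : 3 * (ℓ + 1) ^ (t.j + 1) ≤ r)
    (hL0 : ∀ i : BondIdx Dm, (i.1.1 : ℕ) ≠ t.j → (i.1.1 : ℕ) ≠ t.j + 1 → ¬ NearB t x₀ r i.1.1 i.1.2)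
    (hLj : ∀ β : PBond (PV d ℓ m K hd hL) t.j, NearB t x₀ r t.j β →
      (Dm.LamBond t.j β ↔ (blockOf (eBj t x₀ t.j β).src ∉ t.Λ' ∧ blockOf (eBj t x₀ t.j β).tgt ∉ t.Λ')))
    (hLj1 : ∀ η : PBond (PV d ℓ m K hd hL) (t.j + 1), NearB t x₀ r (t.j + 1) η →
      (Dm.LamBond (t.j + 1) η ↔ ((eBj t x₀ (t.j + 1) η).src ∈ t.Λ' ∨ (eBj t x₀ (t.j + 1) η).tgt ∈ t.Λ')))
    (hWj : ∀ (hlt : t.j < Dm.k + 1) (β : PBond (PV d ℓ m K hd hL) t.j) (hβ : Dm.LamBond t.j β)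
      (hβ' : blockOf (eBj t x₀ t.j β).src ∉ t.Λ' ∧ blockOf (eBj t x₀ t.j β).tgt ∉ t.Λ'), NearB t x₀ r t.j β →
      wG ⟨⟨⟨t.j, hlt⟩, β⟩, hβ⟩ = (c' / (((ℓ + 1 : ℕ) : ℝ) ^ t.j)) ^ 2 * t.w (Sum.inl ⟨eBj t x₀ t.j β, hβ'⟩))
    (hWj1 : ∀ (hlt : t.j + 1 < Dm.k + 1) (η : PBond (PV d ℓ m K hd hL) (t.j + 1)) (hη : Dm.LamBond (t.j + 1) η)
      (hη' : (eBj t x₀ (t.j + 1) η).src ∈ t.Λ' ∨ (eBj t x₀ (t.j + 1) η).tgt ∈ t.Λ'), NearB t x₀ r (t.j + 1) η →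
      wG ⟨⟨⟨t.j + 1, hlt⟩, η⟩, hη⟩ = (c' / (((ℓ + 1 : ℕ) : ℝ) ^ t.j)) ^ 2 * t.w (Sum.inr ⟨eBj t x₀ (t.j + 1) η, hη'⟩))
    (h : PBond (PV d ℓ m K hd hL) 0 → ℝ) (hh : ∀ b, h b ≠ 0 → b ∈ DeepB t x₀ r) :
    onFun (dcsE (P := PV d ℓ m K hd hL) c' ∘ₗ dcE c' + dE c' ∘ₗ dsE c' + QsE Dm ∘ₗ aE Dm wG ∘ₗ QE Dm) * mulOp h =
      (c' / (((ℓ + 1 : ℕ) : ℝ) ^ t.j)) ^ 2 •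
        (transplant (cB t x₀ hx₀ hfit).W (chartBond t posV PBond.dir x₀)
          (onFun (t.D.lapV + LinearMap.adjoint t.D.Q ∘ₗ t.D.a ∘ₗ t.D.Q)) * mulOp h) := by
  have h3 : ∀ b, h b ≠ 0 → b ∈ DeepB t x₀ 3 := fun b hb =>
    deepS_mono (by have := Nat.one_le_pow (t.j + 1) (ℓ + 1) (Nat.succ_pos ℓ); omega) (hh b hb)
  rw [onFun_add (dcsE (P := PV d ℓ m K hd hL) c' ∘ₗ dcE c' + dE c' ∘ₗ dsE c') (QsE Dm ∘ₗ aE Dm wG ∘ₗ QE Dm), add_mul,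
    agree_lapV_member (hx₀ := hx₀) (hfit := hfit) hc' h h3,
    agree_QaQ (hx₀ := hx₀) (hfit := hfit) Dm wG _ hjm hdiv hr hL0 hLj hLj1 hWj hWj1 h hh, transplant_eB_eq, onFun_add t.D.lapV,
    transplant_add, add_mul, smul_add]

/-- **`hagree` OF `B6GlobalChartV1.prop26_2136_V1_of_2134_eq291` IN ITS LITERAL SHAPE** for a member of scale `j` when the global fine
factor is `c′ = L^j` (`s = 1`): `M·h_□ = Ml·h_□` with `M = onFun (∂*∂ + ∂∂* + Q*aQ)` (the minuend of `deltaAE_split`, i.e. `hΔ`) and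
`Ml = ε(Δ_□ + Q*a_□Q)ρ` transplanted along `chartBond` on the full window (the `Ml` of `hinvl_GlV1`), for `h_□` supported at margin `3L^{j+1}`,
given the index-set correspondence near `□` with EQUAL weights. [cite: Balaban1984PropagatorsII, (2.89)–(2.91) p.239] -/
theorem hagree_V1 (Dm : Domains (PV d ℓ m K hd hL)) (wG : BondIdx Dm → ℝ) {r : ℕ}
    (hjm : t.j + 1 ≤ m + K) (hdiv : ∀ μ, ((((ℓ + 1) ^ (t.j + 1) : ℕ) : ℤ)) ∣ x₀ μ) (hr : 3 * (ℓ + 1) ^ (t.j + 1) ≤ r)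
    (hL0 : ∀ i : BondIdx Dm, (i.1.1 : ℕ) ≠ t.j → (i.1.1 : ℕ) ≠ t.j + 1 → ¬ NearB t x₀ r i.1.1 i.1.2)
    (hLj : ∀ β : PBond (PV d ℓ m K hd hL) t.j, NearB t x₀ r t.j β →
      (Dm.LamBond t.j β ↔ (blockOf (eBj t x₀ t.j β).src ∉ t.Λ' ∧ blockOf (eBj t x₀ t.j β).tgt ∉ t.Λ')))
    (hLj1 : ∀ η : PBond (PV d ℓ m K hd hL) (t.j + 1), NearB t x₀ r (t.j + 1) η →
      (Dm.LamBond (t.j + 1) η ↔ ((eBj t x₀ (t.j + 1) η).src ∈ t.Λ' ∨ (eBj t x₀ (t.j + 1) η).tgt ∈ t.Λ')))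
    (hWj : ∀ (hlt : t.j < Dm.k + 1) (β : PBond (PV d ℓ m K hd hL) t.j) (hβ : Dm.LamBond t.j β)
      (hβ' : blockOf (eBj t x₀ t.j β).src ∉ t.Λ' ∧ blockOf (eBj t x₀ t.j β).tgt ∉ t.Λ'), NearB t x₀ r t.j β →
      wG ⟨⟨⟨t.j, hlt⟩, β⟩, hβ⟩ = t.w (Sum.inl ⟨eBj t x₀ t.j β, hβ'⟩))
    (hWj1 : ∀ (hlt : t.j + 1 < Dm.k + 1) (η : PBond (PV d ℓ m K hd hL) (t.j + 1)) (hη : Dm.LamBond (t.j + 1) η)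
      (hη' : (eBj t x₀ (t.j + 1) η).src ∈ t.Λ' ∨ (eBj t x₀ (t.j + 1) η).tgt ∈ t.Λ'), NearB t x₀ r (t.j + 1) η →
      wG ⟨⟨⟨t.j + 1, hlt⟩, η⟩, hη⟩ = t.w (Sum.inr ⟨eBj t x₀ (t.j + 1) η, hη'⟩))
    (h : PBond (PV d ℓ m K hd hL) 0 → ℝ) (hh : ∀ b, h b ≠ 0 → b ∈ DeepB t x₀ r) :
    onFun (dcsE (P := PV d ℓ m K hd hL) ((((ℓ + 1 : ℕ) : ℝ)) ^ t.j) ∘ₗ dcE ((((ℓ + 1 : ℕ) : ℝ)) ^ t.j) +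
        dE ((((ℓ + 1 : ℕ) : ℝ)) ^ t.j) ∘ₗ dsE ((((ℓ + 1 : ℕ) : ℝ)) ^ t.j) + QsE Dm ∘ₗ aE Dm wG ∘ₗ QE Dm) * mulOp h =
      transplant (cB t x₀ hx₀ hfit).W (chartBond t posV PBond.dir x₀)
        (onFun (t.D.lapV + LinearMap.adjoint t.D.Q ∘ₗ t.D.a ∘ₗ t.D.Q)) * mulOp h := by
  have hc : ((((ℓ + 1 : ℕ) : ℝ)) ^ t.j) ≠ 0 := by positivity
  have hs : ((((ℓ + 1 : ℕ) : ℝ)) ^ t.j / (((ℓ + 1 : ℕ) : ℝ)) ^ t.j) ^ 2 = 1 := by rw [div_self hc, one_pow]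
  have key := hagree_member (hx₀ := hx₀) (hfit := hfit) Dm wG hc hjm hdiv hr hL0 hLj hLj1
    (fun hlt β hβ hβ' hn => by rw [hs, one_mul]; exact hWj hlt β hβ hβ' hn)
    (fun hlt η hη hη' hn => by rw [hs, one_mul]; exact hWj1 hlt η hη hη' hn) h hh
  rwa [hs, one_smul] at key

end HAgree

end Literature.MathematicalPhysics.QuantumFieldTheory.Balaban1983to89.B6AgreeQaQV1Chart

end
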